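import Mathlib
import HarnessLib
import Literature.ComputerArithmetic.DeDinechinLauterMullerTorres2013.ZivRoundingTest
import Literature.MathematicalPhysics.QuantumLattice.HeisenbergOrderNeelRiemann3

/-!
# de Dinechin–Lauter–Muller–Torres 2013, Table I: correctly rounding some functions for tiny
arguments in binary64 — the printed rows, checked

[DedinechinEtAl2013] F. de Dinechin, C. Lauter, J.-M. Muller, S. Torres, *On Ziv's rounding test*, ACM
TOMS 39(4):25 (2013), **Table I** (p.16): "Correctly rounding some functions for tiny arguments in the
double-precision/binary64 format, assuming rounding to nearest (that table is extracted from [Muller et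
al. 2010])" — the *Handbook of Floating-Point Arithmetic* (2010). The table reads (function | can be
replaced by | when):

* `expm1(ε)` | `ε` | `|ε| < RN(√2)·2^−53`;  `expm1(ε), ε ≥ 0` | `ε⁺` | `RN(√2)·2^−53 ≤ ε < RN(√3)·2^−52`;
* `log1p(ε)` | `ε` | `|ε| < RN(√2)·2^−53`;
* `sin(ε), sinh(ε), asinh(ε)` | `ε` | `|ε| ≤ α = RN(3^{1/3})·2^−26`;  `arcsin(ε)` | `ε` | `|ε| < α`;
* `tan(ε), atanh(ε)` | `ε` | `|ε| < η = RN(12^{1/3})·2^−27`;  `tanh(ε), arctan(ε)` | `ε` | `|ε| ≤ η`.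

## What is proved here (model: precision-53 floats with unbounded exponents, `IsFloat 53`, and ANY
round-to-nearest `RN`, `IsRoundNearest 53 RN`, from `ZivRoundingTest.lean`; every binary64 number is such a
float and the binary64 grid is a sub-grid, see the remark at `rn_sin_tiny`)

1. The constants: `alpha = 6495314627411702·2^−78` and `eta = 5155334636208885·2^−78` ARE the printed
   `RN(3^{1/3})·2^−26` and `RN(12^{1/3})·2^−27` (`alpha_isRN_cbrt3`, `eta_isRN_cbrt12`: the defining cube
   inequalities, decided by `norm_num`).
2. Rows `sin`, `sinh`, `asinh` (`|ε| ≤ α`) CONFIRMED as theorems for every float and every round-to-nearest: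
   `rn_sin_tiny`, `rn_sinh_tiny`, `rn_arsinh_tiny` (the binade `[2^−26, 2^−25)` is where `α` is sharp —
   `α³ < 6·2^−79` resp. `α³/6 + α⁵/100 < 2^−79` by `norm_num` —, the binades below need only `4 < 6`; at
   powers of two the gap below is halved and `2^(2e+54) ≤ 4 < 6` is what is needed).
3. Rows `tan, atanh` (`|ε| < η`) and `tanh, arctan` (`|ε| ≤ η`) are REFUTED as printed: the float
   `x₁ = 2^−26 − 2^−79` (largest float below `2^−26`, inside both ranges since `η ≈ 1.1447·2^−26`) has
   `RN(tan x₁) = RN(atanh x₁) = 2^−26 ≠ x₁` (`rn_tan_pred_two_zpow_neg26`, `rn_artanh_pred_two_zpow_neg26`),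
   and the power of two `x₀ = 2^−26` has `RN(tanh x₀) = RN(arctan x₀) = 2^−26 − 2^−79 ≠ x₀`
   (`rn_tanh_two_zpow_neg26`, `rn_arctan_two_zpow_neg26`) — for EVERY round-to-nearest (no tie is
   involved: the deviations are `(4/3)·2^−80` against a half-gap of `2^−80`, margin 1/3). Mechanism: in the
   binade `[2^−27, 2^−26)` the ulp is `2^−79`, and `x³/3 < 2^−80` fails for `x > 6^{1/3}·2^−27 ≈ 0.9086·2^−26`;
   the printed `η` is the sharp bound of the binade `[2^−26, 2^−25)` only.
4. The CORRECTED η rows, as theorems for every float and every round-to-nearest, with the bound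
   `beta6 = 8183583624766078·2^−79 ≈ 6^{1/3}·2^−27`: `rn_tan_tiny`, `rn_artanh_tiny` (outer side; `β₆` is
   sharp: `β₆³/3 + β₆⁵/2 < 2^−80` by `norm_num`, and the cell's check shows the next float fails),
   `rn_tanh_tiny`, `rn_arctan_tiny` (inner side; here the numerically sharp bound is one float larger,
   `8183583624766079·2^−79`, which needs the quintic term — proved in item 8). Analytic inputs: Mathlib's
   `sin_gt_sub_cube`, `cos_bound`, `exp_bound`, `abs_log_sub_add_sum_range_le`, `lt_tan`/`le_tan`,
   `hasDerivAt_arctan` (+ `strictMonoOn_of_deriv_pos`), and the tree's Taylor bounds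
   `KLSNumerics.sin_le_taylor_five` / `taylor_six_le_cos`
   (`Literature.MathematicalPhysics.QuantumLattice.HeisenbergOrderNeelRiemann3`, reused, not re-proved).
The cell's two independent numerical implementations (HOME/pub-cert-sw-lit/table1-dlmt13/: decimal series
vs. exact rational interval arithmetic) agree with all of this and confirm every OTHER row of the table
(expm1 ×2, log1p, arcsin) as printed AND sharp.
5. (appended) The quadratic rows `expm1(ε) → ε` and `log1p(ε) → ε` for `|ε| < s2 = RN(√2)·2^−53 =
   6369051672525773·2^−105` (`s2_isRN_sqrt2`), PROVED for every float and every round-to-nearest: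
   `rn_expm1_tiny`, `rn_log1p_tiny` (generic `rn_eq_of_inner_half` / `rn_eq_of_outer_half`; at the powers
   of two `∓2^e` the quadratic deviation equals the quarter-ulp exactly and the cubic term decides; the
   binade `[2^−54, 2^−53)` top float passes by `(4/5)·2^−159`; all sharp by the cell's check).
6. (appended) Row `arcsin(ε) → ε` for `|ε| < α`, PROVED for every float and every round-to-nearest:
   `rn_arcsin_tiny` (`arcsin_bounds`: `x ≤ arcsin x ≤ x + x³/6 + x⁵/10` on `[0, 1/2]` from
   `hasDerivAt_arcsin`; `rn_eq_of_outer_sixth_lt`: top float `pred α = 6495314627411701·2^−78` passes by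
   `norm_num`, and the strict `<` is sharp — AT `α` the deviation exceeds the half-gap, cell check).
7. (appended) The second `expm1` line, `RN(√2)·2^−53 ≤ ε < RN(√3)·2^−52 ⇒ RN(e^ε − 1) = ε⁺` (the successor
   float, `succ_spec`), PROVED for every float and every round-to-nearest, one theorem per binade:
   `rn_expm1_tiny_succ_low` (`s2 ≤ ε < 2^−52`, `ε⁺ = ε + 2^−105`, including the top case `ε⁺ = 2^−52`) and
   `rn_expm1_tiny_succ_high` (`2^−52 ≤ ε < s3 = 7800463371553962·2^−104`, `s3_isRN_sqrt3`, `ε⁺ = ε + 2^−104`),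
   via `rn_eq_succ_of_dev` (deviation strictly between a half-ulp and three half-ulps ⇒ `RN y = ε⁺`); both
   ends are sharp because `RN(√2)` rounds up and `RN(√3)` rounds down (`norm_num` on the exact dyadics).
With 5–7 every claim printed in Table I is either a theorem here (rows expm1 ×2, log1p, sin, sinh, asinh,
arcsin) or refuted here with a proved correction (rows tan, atanh, tanh, arctan).
8. (appended) The corrections are SHARP, as theorems for every round-to-nearest: with
   `beta7 = 8183583624766079·2^−79` (the float after `β₆`; `β₆ < 6^{1/3}·2^−27 < β₇`, `beta7_isFloat`),
   `rn_tanh_tiny_sharp` and `rn_arctan_tiny_sharp` extend the `tanh`/`arctan` rows to `|ε| ≤ β₇` (seven-term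
   enclosures `tanh_quintic_bounds` — bootstrapped from `tanh' = 1 − tanh²` — and `arctan_quintic_bounds`;
   generic `rn_eq_of_inner_third_sharp`), and the next float FAILS in all four rows: `rn_tan_beta7`,
   `rn_artanh_beta7` (`RN f(β₇) = β₇ + 2^−79`, via `add_cube_div_three_le_tan`, `artanh_lower_quintic`),
   `rn_tanh_succ_beta7`, `rn_arctan_succ_beta7` (`RN f(β₇ + 2^−79) = β₇`). So the largest ranges of the
   printed shape on which the η rows hold are: `tan, atanh → ε` for `|ε| ≤ β₆`; `tanh, arctan → ε` for
   `|ε| ≤ β₇` (the cell's two numerical implementations found exactly these floats by bisection).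
-/

namespace Literature.ComputerArithmetic.DeDinechinLauterMullerTorres2013

open Real

/-! ### The two printed constants -/

/-- `α = RN(3^{1/3}) × 2^−26` of Table I, as the exact dyadic `6495314627411702 · 2^−78`
(`RN(3^{1/3}) = 6495314627411702·2^−52`, see `alpha_isRN_cbrt3`). [cite: DedinechinEtAl2013, Table I] -/
noncomputable def alpha : ℝ := 6495314627411702 / 2 ^ 78

/-- `η = RN(12^{1/3}) × 2^−27` of Table I, as the exact dyadic `5155334636208885 · 2^−78`
(`RN(12^{1/3}) = 5155334636208885·2^−51`, see `eta_isRN_cbrt12`). [cite: DedinechinEtAl2013, Table I] -/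
noncomputable def eta : ℝ := 5155334636208885 / 2 ^ 78

/-- Unfolding `alpha`. [cite: DedinechinEtAl2013, Table I] -/
theorem alpha_eq : alpha = 6495314627411702 / 2 ^ 78 := rfl

/-- Unfolding `eta`. [cite: DedinechinEtAl2013, Table I] -/
theorem eta_eq : eta = 5155334636208885 / 2 ^ 78 := rfl

/-- `6495314627411702·2^−52` is the binary64 number nearest to `3^{1/3}`: with `m = 6495314627411702`,
`((2m−1)/2^53)^3 < 3 < ((2m+1)/2^53)^3`, i.e. `3^{1/3}` lies strictly within half an ulp of `m·2^−52`
(and `m` has 53 bits). So `alpha = RN(3^{1/3})·2^−26` as printed. [cite: DedinechinEtAl2013, Table I] -/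
theorem alpha_isRN_cbrt3 :
    (2 * 6495314627411702 - 1 : ℤ) ^ 3 < 3 * 2 ^ 159 ∧ 3 * 2 ^ 159 < (2 * 6495314627411702 + 1 : ℤ) ^ 3
      ∧ 2 ^ 52 ≤ (6495314627411702 : ℤ) ∧ (6495314627411702 : ℤ) < 2 ^ 53 := by
  refine ⟨by norm_num, by norm_num, by norm_num, by norm_num⟩

/-- `5155334636208885·2^−51` is the binary64 number nearest to `12^{1/3}` (`((2m−1)/2^52)^3 < 12 <
((2m+1)/2^52)^3`, `m` has 53 bits), so `eta = RN(12^{1/3})·2^−27` as printed; note `2^−26 < eta < 2^−25`.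
[cite: DedinechinEtAl2013, Table I] -/
theorem eta_isRN_cbrt12 :
    (2 * 5155334636208885 - 1 : ℤ) ^ 3 < 12 * 2 ^ 156 ∧ 12 * 2 ^ 156 < (2 * 5155334636208885 + 1 : ℤ) ^ 3
      ∧ 2 ^ 52 ≤ (5155334636208885 : ℤ) ∧ (5155334636208885 : ℤ) < 2 ^ 53
      ∧ (2 : ℝ) ^ (-26 : ℤ) < eta ∧ eta < (2 : ℝ) ^ (-25 : ℤ) := by
  refine ⟨by norm_num, by norm_num, by norm_num, by norm_num, ?_, ?_⟩ <;> rw [eta_eq] <;> norm_num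

/-! ### The η rows are false as printed: four witnesses, for every round-to-nearest -/

section EtaRows

variable {RN : ℝ → ℝ}

/-- The largest float below `2^−26`: `x₁ = 2^−26 − 2^−79 = (2^53 − 1)·2^−79` is a precision-53 float.
[cite: DedinechinEtAl2013, §1.1] -/
theorem isFloat_pred_two_zpow_neg26 : IsFloat 53 ((2 : ℝ) ^ (-26 : ℤ) - (2 : ℝ) ^ (-79 : ℤ)) := by
  refine ⟨2 ^ 53 - 1, -79, by norm_num, ?_⟩
  push_cast
  norm_num

/-- `cos z > 0` for `0 ≤ z ≤ 1` (from `1 − z²/2 ≤ cos z`). [cite: DedinechinEtAl2013, Table I] -/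
theorem cos_pos_of_le_one {z : ℝ} (hz0 : 0 ≤ z) (hz : z ≤ 1) : 0 < Real.cos z := by
  have := Real.one_sub_sq_div_two_le_cos (x := z)
  nlinarith

/-- Two-sided rational enclosure of `tan z` for `0 < z ≤ 1`:
`(z − z³/6)/(1 − z²/2 + (5/96) z⁴) ≤ tan z ≤ z/(1 − z²/2)` (Mathlib's `sin_gt_sub_cube`, `sin_lt`,
`cos_bound`, `one_sub_sq_div_two_le_cos`). [cite: DedinechinEtAl2013, Table I] -/
theorem tan_enclosure {z : ℝ} (hz0 : 0 < z) (hz : z ≤ 1) :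
    (z - z ^ 3 / 6) / (1 - z ^ 2 / 2 + 5 / 96 * z ^ 4) ≤ Real.tan z
      ∧ Real.tan z ≤ z / (1 - z ^ 2 / 2) := by
  have hc := cos_pos_of_le_one hz0.le hz
  have hclo := Real.one_sub_sq_div_two_le_cos (x := z)
  have hcb := Real.cos_bound (show |z| ≤ 1 by rw [abs_of_pos hz0]; exact hz)
  rw [abs_of_pos hz0] at hcb
  have hchi : Real.cos z ≤ 1 - z ^ 2 / 2 + 5 / 96 * z ^ 4 := by
    have := (abs_le.1 hcb).2; linarith
  have hslo := Real.sin_gt_sub_cube hz0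
  have hshi := Real.sin_lt hz0
  have hden1 : 0 < 1 - z ^ 2 / 2 := by nlinarith
  have hden2 : 0 < 1 - z ^ 2 / 2 + 5 / 96 * z ^ 4 := by positivity
  rw [Real.tan_eq_sin_div_cos]
  constructor
  · -- (z − z³/6)/(C_hi) ≤ sin/cos
    rw [div_le_div_iff₀ hden2 hc]
    have h1 : (z - z ^ 3 / 6) * Real.cos z ≤ (z - z ^ 3 / 6) * (1 - z ^ 2 / 2 + 5 / 96 * z ^ 4) :=
      mul_le_mul_of_nonneg_left hchi (by nlinarith)
    have h2 : (z - z ^ 3 / 6) * (1 - z ^ 2 / 2 + 5 / 96 * z ^ 4)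
        ≤ Real.sin z * (1 - z ^ 2 / 2 + 5 / 96 * z ^ 4) :=
      mul_le_mul_of_nonneg_right hslo.le hden2.le
    linarith
  · rw [div_le_div_iff₀ hc hden1]
    have h1 : Real.sin z * (1 - z ^ 2 / 2) ≤ z * (1 - z ^ 2 / 2) :=
      mul_le_mul_of_nonneg_right hshi.le hden1.le
    have h2 : z * (1 - z ^ 2 / 2) ≤ z * Real.cos z := mul_le_mul_of_nonneg_left hclo hz0.le
    linarith

/-- **Row `tan` of Table I is false as printed.** For `x₁ = 2^−26 − 2^−79` (a binary64 number with
`|x₁| < η`), `tan x₁ − x₁ = (4/3)·2^−80·(1 − O(2^−52))` exceeds the half-gap `2^−80` above `x₁`, so EVERY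
round-to-nearest returns the successor: `RN(tan x₁) = 2^−26 ≠ x₁`. [cite: DedinechinEtAl2013, Table I] -/
theorem rn_tan_pred_two_zpow_neg26 (hRN : IsRoundNearest 53 RN) :
    RN (Real.tan ((2 : ℝ) ^ (-26 : ℤ) - (2 : ℝ) ^ (-79 : ℤ))) = (2 : ℝ) ^ (-26 : ℤ)
      ∧ (2 : ℝ) ^ (-26 : ℤ) - (2 : ℝ) ^ (-79 : ℤ) < eta := by
  have hx : (2 : ℝ) ^ (-26 : ℤ) - (2 : ℝ) ^ (-79 : ℤ) = 9007199254740991 / 2 ^ 79 := by norm_num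
  refine ⟨?_, by rw [eta_eq]; norm_num⟩
  obtain ⟨hlo, hhi⟩ := tan_enclosure (z := 9007199254740991 / 2 ^ 79) (by norm_num) (by norm_num)
  rw [hx]
  apply hRN.rn_eq_two_zpow (by norm_num) (e := -26)
  · refine lt_of_lt_of_le ?_ hlo
    norm_num
  · refine lt_of_le_of_lt hhi ?_
    norm_num

/-- **Row `arctan` of Table I is false as printed.** At the power of two `x₀ = 2^−26` (`|x₀| ≤ η`),
`x₀ − arctan x₀ = (4/3)·2^−80·(1 − O(2^−52))` exceeds the half-gap `2^−80` BELOW `2^−26` (the predecessor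
of `2^−26` is `2^−26 − 2^−79`), so every round-to-nearest returns `RN(arctan 2^−26) = 2^−26 − 2^−79 ≠ 2^−26`.
Proof: `tan(x₁ − 2^−80) < 2^−26 < tan(x₁ + 2^−80)` by `tan_enclosure`, transported through the strictly
monotone `arctan`. [cite: DedinechinEtAl2013, Table I] -/
theorem rn_arctan_two_zpow_neg26 (hRN : IsRoundNearest 53 RN) :
    RN (Real.arctan ((2 : ℝ) ^ (-26 : ℤ))) = (2 : ℝ) ^ (-26 : ℤ) - (2 : ℝ) ^ (-79 : ℤ)
      ∧ (2 : ℝ) ^ (-26 : ℤ) ≤ eta := by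
  refine ⟨?_, by rw [eta_eq]; norm_num⟩
  have hpi := Real.pi_gt_three
  -- arctan x₀ > z₁ := x₁ − 2^−80 and arctan x₀ < z₂ := x₁ + 2^−80
  have hz1 : (9007199254740991 / 2 ^ 79 - 1 / 2 ^ 80 : ℝ) < Real.arctan ((2 : ℝ) ^ (-26 : ℤ)) := by
    obtain ⟨-, hhi⟩ := tan_enclosure (z := 9007199254740991 / 2 ^ 79 - 1 / 2 ^ 80) (by norm_num) (by norm_num)
    have ht : Real.tan (9007199254740991 / 2 ^ 79 - 1 / 2 ^ 80 : ℝ) < (2 : ℝ) ^ (-26 : ℤ) :=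
      lt_of_le_of_lt hhi (by norm_num)
    have := Real.arctan_strictMono ht
    rwa [Real.arctan_tan (by norm_num; linarith) (by norm_num; linarith)] at this
  have hz2 : Real.arctan ((2 : ℝ) ^ (-26 : ℤ)) < (9007199254740991 / 2 ^ 79 + 1 / 2 ^ 80 : ℝ) := by
    obtain ⟨hlo, -⟩ := tan_enclosure (z := 9007199254740991 / 2 ^ 79 + 1 / 2 ^ 80) (by norm_num) (by norm_num)
    have ht : (2 : ℝ) ^ (-26 : ℤ) < Real.tan (9007199254740991 / 2 ^ 79 + 1 / 2 ^ 80 : ℝ) :=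
      lt_of_lt_of_le (by norm_num) hlo
    have := Real.arctan_strictMono ht
    rwa [Real.arctan_tan (by norm_num; linarith) (by norm_num; linarith)] at this
  have hx : (2 : ℝ) ^ (-26 : ℤ) - (2 : ℝ) ^ (-79 : ℤ) = 9007199254740991 / 2 ^ 79 := by norm_num
  rw [hx]
  apply hRN.rn_eq_of_abs_sub_lt_half_ulp (by norm_num) (hx ▸ isFloat_pred_two_zpow_neg26) (e := -27)
    (by norm_num)
  rw [abs_sub_lt_iff]
  constructor
  · norm_num at hz1 hz2 ⊢; linarith
  · norm_num at hz1 hz2 ⊢; linarith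

/-- **Row `tanh` of Table I is false as printed.** At `x₀ = 2^−26` (`|x₀| ≤ η`): `x₀ − tanh x₀ =
(4/3)·2^−80·(1 − O(2^−52)) > 2^−80` = the half-gap below `2^−26`, so every round-to-nearest returns
`RN(tanh 2^−26) = 2^−26 − 2^−79 ≠ 2^−26`. Proof: `tanh x₀ = (e^{2x₀} − 1)/(e^{2x₀} + 1)` with `e^{2^−25}`
enclosed by Mathlib's `Real.exp_bound` (4 terms). [cite: DedinechinEtAl2013, Table I] -/
theorem rn_tanh_two_zpow_neg26 (hRN : IsRoundNearest 53 RN) :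
    RN (Real.tanh ((2 : ℝ) ^ (-26 : ℤ))) = (2 : ℝ) ^ (-26 : ℤ) - (2 : ℝ) ^ (-79 : ℤ)
      ∧ (2 : ℝ) ^ (-26 : ℤ) ≤ eta := by
  refine ⟨?_, by rw [eta_eq]; norm_num⟩
  -- tanh x₀ = (e^{2x₀} − 1)/(e^{2x₀} + 1), 2x₀ = 2^−25 (identity as in `Literature.Dynamics.Contraction.tanh_eq_exp_two_mul`)
  have htanh : Real.tanh ((2 : ℝ) ^ (-26 : ℤ))
      = (Real.exp (1 / 2 ^ 25 : ℝ) - 1) / (Real.exp (1 / 2 ^ 25 : ℝ) + 1) := by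
    rw [Real.tanh_eq_sinh_div_cosh, Real.sinh_eq, Real.cosh_eq]
    have h1 : Real.exp (1 / 2 ^ 25 : ℝ) = Real.exp ((2 : ℝ) ^ (-26 : ℤ)) * Real.exp ((2 : ℝ) ^ (-26 : ℤ)) := by
      rw [← Real.exp_add]; norm_num
    have hpos := Real.exp_pos ((2 : ℝ) ^ (-26 : ℤ))
    rw [h1, Real.exp_neg]
    field_simp
  rw [htanh]
  -- enclosure of u = exp(2^-25) from four Taylor terms
  have hb := Real.exp_bound (x := 1 / 2 ^ 25) (by norm_num) (show 0 < 4 by norm_num)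
  obtain ⟨k1, k2⟩ := abs_sub_le_iff.1 hb
  norm_num [Finset.sum_range_succ, Nat.factorial] at k1 k2
  have hu0 : 0 < Real.exp (1 / 2 ^ 25 : ℝ) + 1 := by positivity
  have hTlo : (9007199254740991 / 2 ^ 79 - 1 / 2 ^ 80 : ℝ)
      < (Real.exp (1 / 2 ^ 25 : ℝ) - 1) / (Real.exp (1 / 2 ^ 25 : ℝ) + 1) := by
    rw [lt_div_iff₀ hu0]; norm_num at k1 k2 ⊢; linarith
  have hThi : (Real.exp (1 / 2 ^ 25 : ℝ) - 1) / (Real.exp (1 / 2 ^ 25 : ℝ) + 1)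
      < (9007199254740991 / 2 ^ 79 + 1 / 2 ^ 80 : ℝ) := by
    rw [div_lt_iff₀ hu0]; norm_num at k1 k2 ⊢; linarith
  have hx : (2 : ℝ) ^ (-26 : ℤ) - (2 : ℝ) ^ (-79 : ℤ) = 9007199254740991 / 2 ^ 79 := by norm_num
  rw [hx]
  apply hRN.rn_eq_of_abs_sub_lt_half_ulp (by norm_num) (hx ▸ isFloat_pred_two_zpow_neg26) (e := -27)
    (by norm_num)
  rw [abs_sub_lt_iff]
  constructor
  · norm_num at hTlo hThi ⊢; linarith
  · norm_num at hTlo hThi ⊢; linarith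

/-- **Row `atanh` of Table I is false as printed.** For `x₁ = 2^−26 − 2^−79` (`|x₁| < η`):
`atanh x₁ − x₁ = (4/3)·2^−80·(1 − O(2^−52)) > 2^−80` = the half-gap above `x₁`, so every round-to-nearest
returns `RN(atanh x₁) = 2^−26 ≠ x₁`. Proof: `atanh x = ½(log(1+x) − log(1−x))` with both logarithms
enclosed by Mathlib's `Real.abs_log_sub_add_sum_range_le` (3 terms). [cite: DedinechinEtAl2013, Table I] -/
theorem rn_artanh_pred_two_zpow_neg26 (hRN : IsRoundNearest 53 RN) :
    RN (Real.artanh ((2 : ℝ) ^ (-26 : ℤ) - (2 : ℝ) ^ (-79 : ℤ))) = (2 : ℝ) ^ (-26 : ℤ)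
      ∧ (2 : ℝ) ^ (-26 : ℤ) - (2 : ℝ) ^ (-79 : ℤ) < eta := by
  refine ⟨?_, by rw [eta_eq]; norm_num⟩
  have hx : (2 : ℝ) ^ (-26 : ℤ) - (2 : ℝ) ^ (-79 : ℤ) = 9007199254740991 / 2 ^ 79 := by norm_num
  rw [hx]
  have hnum : (2 : ℝ) ^ (-26 : ℤ) - (2 : ℝ) ^ (-26 - (53 : ℕ) + 1 : ℤ) / 4
      < 9007199254740991 / 2 ^ 79 + (9007199254740991 / 2 ^ 79) ^ 3 / 3 - 2 * (9007199254740991 / 2 ^ 79) ^ 4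
      ∧ (9007199254740991 / 2 ^ 79 + (9007199254740991 / 2 ^ 79) ^ 3 / 3 + 2 * (9007199254740991 / 2 ^ 79) ^ 4 : ℝ)
      < (2 : ℝ) ^ (-26 : ℤ) + (2 : ℝ) ^ (-26 - (53 : ℕ) + 1 : ℤ) / 2 := by
    constructor <;> norm_num
  generalize hxdef : (9007199254740991 / 2 ^ 79 : ℝ) = x at hnum ⊢
  have hx0 : 0 < x := by rw [← hxdef]; norm_num
  have hx1 : x ≤ 1 / 2 := by rw [← hxdef]; norm_num
  have hart : Real.artanh x = 1 / 2 * (Real.log (1 + x) - Real.log (1 - x)) := by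
    rw [Real.artanh_eq_half_log ⟨by linarith, by linarith⟩, Real.log_div (by linarith) (by linarith)]
  -- log(1 - x) and log(1 + x) = log(1 - (-x)) to third order, error E = x⁴/(1-x) ≤ 2x⁴
  have hl1 := Real.abs_log_sub_add_sum_range_le (x := x) (by rw [abs_of_pos hx0]; linarith) 3
  have hl2 := Real.abs_log_sub_add_sum_range_le (x := -x) (by rw [abs_neg, abs_of_pos hx0]; linarith) 3
  rw [abs_of_pos hx0] at hl1
  rw [abs_neg, abs_of_pos hx0, sub_neg_eq_add] at hl2
  have hden : 0 < 1 - x := by linarith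
  obtain ⟨a1, a2⟩ := abs_le.1 hl1
  obtain ⟨b1, b2⟩ := abs_le.1 hl2
  simp only [Finset.sum_range_succ, Finset.sum_range_zero] at a1 a2 b1 b2
  norm_num at a1 a2 b1 b2
  have hE : x ^ 4 / (1 - x) ≤ 2 * x ^ 4 := by
    rw [div_le_iff₀ hden]; nlinarith [pow_nonneg hx0.le 4]
  -- lower/upper bounds of artanh x
  have hlo : x + x ^ 3 / 3 - 2 * x ^ 4 ≤ Real.artanh x := by rw [hart]; linarith
  have hhi : Real.artanh x ≤ x + x ^ 3 / 3 + 2 * x ^ 4 := by rw [hart]; linarith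
  exact hRN.rn_eq_two_zpow (by norm_num) (e := -26) (lt_of_lt_of_le hnum.1 hlo) (lt_of_le_of_lt hhi hnum.2)

end EtaRows

/-! ### Row `sin` confirmed: `RN(sin ε) = ε` for every float `|ε| ≤ α` -/

section SinRow

variable {RN : ℝ → ℝ}

/-- Every positive real lies in a binade `[2^e, 2^(e+1))`. [cite: DedinechinEtAl2013, §1.1] -/
theorem exists_binade {x : ℝ} (hx : 0 < x) : ∃ e : ℤ, (2 : ℝ) ^ e ≤ x ∧ x < (2 : ℝ) ^ (e + 1) := by
  refine ⟨Int.log 2 x, ?_, ?_⟩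
  · exact_mod_cast Int.zpow_log_le_self (b := 2) (R := ℝ) one_lt_two hx
  · exact_mod_cast Int.lt_zpow_succ_log_self (b := 2) (R := ℝ) one_lt_two x

/-- Rounding decision, INNER/OUTER side of a float that is not a power of two, precision 53:
`|x − y| < 2^(e−53)` (= ½ulp) with `2^e < x` ⇒ `RN y = x`. [cite: DedinechinEtAl2013, §2.1.1] -/
theorem rn_eq_of_abs_sub_lt_53 (hRN : IsRoundNearest 53 RN) {x y : ℝ} {e : ℤ} (hx : IsFloat 53 x)
    (he : (2 : ℝ) ^ e < x) (hd : |x - y| < (2 : ℝ) ^ (e - 53)) : RN y = x := by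
  apply hRN.rn_eq_of_abs_sub_lt_half_ulp (by norm_num) hx he
  refine lt_of_lt_of_le hd ?_
  rw [le_div_iff₀ two_pos, ← zpow_add_one₀ two_ne_zero]
  apply le_of_eq; congr 1

/-- Rounding decision at a power of two, precision 53: `2^e − 2^(e−54) < y < 2^e + 2^(e−53)` ⇒
`RN y = 2^e` (the gap below `2^e` is half the gap above). [cite: DedinechinEtAl2013, §2.1.2] -/
theorem rn_eq_two_zpow_53 (hRN : IsRoundNearest 53 RN) {y : ℝ} {e : ℤ}
    (hlo : (2 : ℝ) ^ e - (2 : ℝ) ^ (e - 54) < y) (hhi : y < (2 : ℝ) ^ e + (2 : ℝ) ^ (e - 53)) :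
    RN y = (2 : ℝ) ^ e := by
  have h4 : (2 : ℝ) ^ (e - (53 : ℕ) + 1) / 4 = (2 : ℝ) ^ (e - 54) := by
    rw [div_eq_iff (by norm_num : (4 : ℝ) ≠ 0), show (4 : ℝ) = 2 * 2 by norm_num, ← mul_assoc,
      ← zpow_add_one₀ two_ne_zero, ← zpow_add_one₀ two_ne_zero]
    congr 1; push_cast; ring
  have h2 : (2 : ℝ) ^ (e - (53 : ℕ) + 1) / 2 = (2 : ℝ) ^ (e - 53) := by
    rw [div_eq_iff (by norm_num : (2 : ℝ) ≠ 0), ← zpow_add_one₀ two_ne_zero]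
    congr 1
  apply hRN.rn_eq_two_zpow (by norm_num)
  · rw [h4]; exact hlo
  · rw [h2]; exact hhi

/-- Row `sin`, positive arguments: for a precision-53 float `0 < ε ≤ α = RN(3^{1/3})·2^−26` and ANY
round-to-nearest `RN`, `RN(sin ε) = ε`. The margin: `0 < ε − sin ε < ε³/6` (Mathlib `Real.sin_gt_sub_cube`),
and `ε³/6 < ½ulp(ε)` — in the binade `[2^−26, 2^−25)` exactly because `ε ≤ α` (`α³ < 6·2^−79`, sharp), in
the binades below because `4 < 6`, and at powers of two `ε = 2^e` (where the gap below is halved) because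
`2^(2e+54) ≤ 4 < 6`. [cite: DedinechinEtAl2013, Table I] -/
theorem rn_sin_tiny_pos (hRN : IsRoundNearest 53 RN) {ε : ℝ} (hε : IsFloat 53 ε) (h0 : 0 < ε)
    (hα : ε ≤ alpha) : RN (Real.sin ε) = ε := by
  obtain ⟨e, he1, he2⟩ := exists_binade h0
  have hα25 : alpha < (2 : ℝ) ^ (-25 : ℤ) := by rw [alpha_eq]; norm_num
  have he26 : e ≤ -26 := by
    have h1 : (2 : ℝ) ^ e < (2 : ℝ) ^ (-25 : ℤ) := lt_of_le_of_lt he1 (lt_of_le_of_lt hα hα25)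
    have := (zpow_lt_zpow_iff_right₀ (by norm_num : (1 : ℝ) < 2)).1 h1
    omega
  have hs1 : Real.sin ε < ε := Real.sin_lt h0
  have hs2 : ε - ε ^ 3 / 6 < Real.sin ε := Real.sin_gt_sub_cube h0
  have hU : (0 : ℝ) < (2 : ℝ) ^ (e - 53) := by positivity
  rcases he1.lt_or_eq with hne | heq
  · -- ε is not a power of two: ε − sin ε < ½ulp = 2^(e−53)
    apply rn_eq_of_abs_sub_lt_53 hRN hε hne
    rw [abs_of_pos (by linarith)]
    have key : ε ^ 3 / 6 ≤ (2 : ℝ) ^ (e - 53) := by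
      rcases (show e = -26 ∨ e ≤ -27 by omega) with h26 | h27
      · subst h26
        have h3 : ε ^ 3 ≤ alpha ^ 3 := pow_le_pow_left₀ h0.le hα 3
        rw [alpha_eq] at h3
        have hnum : ((6495314627411702 / 2 ^ 78 : ℝ)) ^ 3 / 6 ≤ (2 : ℝ) ^ ((-26 : ℤ) - 53) := by
          norm_num
        linarith
      · have h3 : ε ^ 3 < ((2 : ℝ) ^ (e + 1)) ^ 3 := pow_lt_pow_left₀ he2 h0.le (by norm_num)
        have hsplit : ((2 : ℝ) ^ (e + 1)) ^ 3 = (2 : ℝ) ^ (e - 53) * (2 : ℝ) ^ (2 * e + 56) := by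
          rw [← zpow_natCast, ← zpow_mul, ← zpow_add₀ (by norm_num)]; congr 1; push_cast; ring
        have hsmall : (2 : ℝ) ^ (2 * e + 56) ≤ (2 : ℝ) ^ (2 : ℤ) :=
          zpow_le_zpow_right₀ (by norm_num) (by omega)
        have h22 : (2 : ℝ) ^ (2 : ℤ) = 4 := by norm_num
        rw [h22] at hsmall
        have := mul_le_mul_of_nonneg_left hsmall hU.le
        rw [← hsplit] at this
        linarith
    linarith
  · -- ε = 2^e: the gap below is ¼ulp = 2^(e−54)
    rw [← heq] at hs1 hs2 ⊢
    have hq : (2 : ℝ) ^ (e - 53) = 2 * (2 : ℝ) ^ (e - 54) := by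
      rw [show e - 53 = (e - 54) + 1 by ring, zpow_add_one₀ two_ne_zero]; ring
    apply rn_eq_two_zpow_53 hRN
    · have hsplit : ((2 : ℝ) ^ e) ^ 3 = (2 : ℝ) ^ (e - 53) * (2 : ℝ) ^ (2 * e + 53) := by
        rw [← zpow_natCast, ← zpow_mul, ← zpow_add₀ (by norm_num)]; congr 1; push_cast; ring
      have hsmall : (2 : ℝ) ^ (2 * e + 53) ≤ (2 : ℝ) ^ (1 : ℤ) :=
        zpow_le_zpow_right₀ (by norm_num) (by omega)
      rw [zpow_one] at hsmall
      have := mul_le_mul_of_nonneg_left hsmall hU.le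
      rw [← hsplit] at this
      -- (2^e)^3/6 ≤ 2·2^(e-53)/6 = 2^(e-53)/3 = (2/3)·2^(e-54) < 2^(e-54)
      linarith
    · linarith

/-- **Row `sin` of Table I, CONFIRMED as a theorem:** for every precision-53 float `ε` with
`|ε| ≤ α = RN(3^{1/3})·2^−26` and every round-to-nearest `RN` (any tie rule) into the precision-53 floats
with unbounded exponents, `RN(sin ε) = ε`. Binary64 reading: every binary64 number (subnormals included)
is such a float, and the binary64 numbers form a sub-grid, so a binary64 round-to-nearest of `sin ε` is
`ε` as well (no other precision-53 float, a fortiori no other binary64 number, is as close). Negative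
arguments by the odd symmetry of `sin` and of the float grid (`IsRoundNearest.mirror`). The bound is
sharp: the cell's check shows the claim fails at the successor of `α`. [cite: DedinechinEtAl2013, Table I] -/
theorem rn_sin_tiny (hRN : IsRoundNearest 53 RN) {ε : ℝ} (hε : IsFloat 53 ε) (hα : |ε| ≤ alpha) :
    RN (Real.sin ε) = ε := by
  rcases lt_trichotomy ε 0 with hneg | hzero | hpos
  · have h := rn_sin_tiny_pos hRN.mirror hε.neg (neg_pos.2 hneg) (by rwa [abs_of_neg hneg] at hα)
    simp only [Real.sin_neg, neg_neg] at h
    linarith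
  · subst hzero
    rw [Real.sin_zero]
    have h0 := hRN.nearest 0 0 ⟨0, 0, by norm_num, by simp⟩
    simp only [sub_zero, sub_self, abs_zero] at h0
    exact abs_nonpos_iff.1 h0
  · exact rn_sin_tiny_pos hRN hε hpos (by rwa [abs_of_pos hpos] at hα)

end SinRow

/-! ### Row `sinh` confirmed: `RN(sinh ε) = ε` for every float `|ε| ≤ α` -/

section SinhRow

variable {RN : ℝ → ℝ}

/-- `0 ≤ sinh x − x ≤ x³/6 + x⁵/100` for `0 ≤ x ≤ 1` (five Taylor terms of `e^{±x}`, Mathlib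
`Real.exp_bound`). [cite: DedinechinEtAl2013, Table I] -/
theorem sinh_sub_self_le {x : ℝ} (hx0 : 0 ≤ x) (hx1 : x ≤ 1) :
    0 ≤ Real.sinh x - x ∧ Real.sinh x - x ≤ x ^ 3 / 6 + x ^ 5 / 100 := by
  have hxa : |x| ≤ 1 := by rw [abs_of_nonneg hx0]; exact hx1
  have hxa' : |-x| ≤ 1 := by rw [abs_neg]; exact hxa
  have h1 := Real.exp_bound hxa (show 0 < 5 by norm_num)
  have h2 := Real.exp_bound hxa' (show 0 < 5 by norm_num)
  rw [abs_of_nonneg hx0] at h1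
  rw [abs_neg, abs_of_nonneg hx0] at h2
  obtain ⟨a1, a2⟩ := abs_sub_le_iff.1 h1
  obtain ⟨b1, b2⟩ := abs_sub_le_iff.1 h2
  simp only [Finset.sum_range_succ, Finset.sum_range_zero, Nat.factorial] at a1 a2 b1 b2
  norm_num at a1 a2 b1 b2
  rw [Real.sinh_eq]
  constructor
  · have := Real.self_le_sinh_iff.2 hx0
    rw [Real.sinh_eq] at this
    linarith
  · linarith

/-- Row `sinh`, positive arguments (`0 < ε ≤ α`): `sinh ε` lies above `ε` (outer side, where the gap is a
full ulp even at powers of two) by less than `ε³/6 + ε⁵/100 < ½ulp(ε)`; in the top binade this is the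
sharp inequality `α³/6 + α⁵/100 < 2^−79`. [cite: DedinechinEtAl2013, Table I] -/
theorem rn_sinh_tiny_pos (hRN : IsRoundNearest 53 RN) {ε : ℝ} (hε : IsFloat 53 ε) (h0 : 0 < ε)
    (hα : ε ≤ alpha) : RN (Real.sinh ε) = ε := by
  obtain ⟨e, he1, he2⟩ := exists_binade h0
  have hα25 : alpha < (2 : ℝ) ^ (-25 : ℤ) := by rw [alpha_eq]; norm_num
  have hα1 : alpha ≤ 1 := by rw [alpha_eq]; norm_num
  have he26 : e ≤ -26 := by
    have h1 : (2 : ℝ) ^ e < (2 : ℝ) ^ (-25 : ℤ) := lt_of_le_of_lt he1 (lt_of_le_of_lt hα hα25)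
    have := (zpow_lt_zpow_iff_right₀ (by norm_num : (1 : ℝ) < 2)).1 h1
    omega
  obtain ⟨hs1, hs2⟩ := sinh_sub_self_le h0.le (hα.trans hα1)
  have hU : (0 : ℝ) < (2 : ℝ) ^ (e - 53) := by positivity
  -- the deviation is below ½ulp = 2^(e−53)
  have key : ε ^ 3 / 6 + ε ^ 5 / 100 < (2 : ℝ) ^ (e - 53) := by
    rcases (show e = -26 ∨ e ≤ -27 by omega) with h26 | h27
    · subst h26
      have h3 : ε ^ 3 ≤ alpha ^ 3 := pow_le_pow_left₀ h0.le hα 3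
      have h5 : ε ^ 5 ≤ alpha ^ 5 := pow_le_pow_left₀ h0.le hα 5
      rw [alpha_eq] at h3 h5
      have hnum : ((6495314627411702 / 2 ^ 78 : ℝ)) ^ 3 / 6 + ((6495314627411702 / 2 ^ 78 : ℝ)) ^ 5 / 100
          < (2 : ℝ) ^ ((-26 : ℤ) - 53) := by
        norm_num
      linarith
    · have h3 : ε ^ 3 < ((2 : ℝ) ^ (e + 1)) ^ 3 := pow_lt_pow_left₀ he2 h0.le (by norm_num)
      have hε1 : ε ≤ 1 := hα.trans hα1
      have h5 : ε ^ 5 ≤ ε ^ 3 := pow_le_pow_of_le_one h0.le hε1 (by norm_num)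
      have hsplit : ((2 : ℝ) ^ (e + 1)) ^ 3 = (2 : ℝ) ^ (e - 53) * (2 : ℝ) ^ (2 * e + 56) := by
        rw [← zpow_natCast, ← zpow_mul, ← zpow_add₀ (by norm_num)]; congr 1; push_cast; ring
      have hsmall : (2 : ℝ) ^ (2 * e + 56) ≤ (2 : ℝ) ^ (2 : ℤ) :=
        zpow_le_zpow_right₀ (by norm_num) (by omega)
      have h22 : (2 : ℝ) ^ (2 : ℤ) = 4 := by norm_num
      rw [h22] at hsmall
      have := mul_le_mul_of_nonneg_left hsmall hU.le
      rw [← hsplit] at this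
      -- ε³ < 4·U, so ε³/6 + ε⁵/100 ≤ ε³(1/6 + 1/100) < 4U·(53/300) < U
      nlinarith
  rcases he1.lt_or_eq with hne | heq
  · apply rn_eq_of_abs_sub_lt_53 hRN hε hne
    rw [abs_of_nonpos (by linarith)]
    linarith
  · rw [← heq] at hs1 hs2 key ⊢
    have hV : (0 : ℝ) < (2 : ℝ) ^ (e - 54) := by positivity
    exact rn_eq_two_zpow_53 hRN (by linarith) (by linarith)

/-- **Row `sinh` of Table I, CONFIRMED as a theorem:** for every precision-53 float `ε` with `|ε| ≤ α` and
every round-to-nearest `RN`, `RN(sinh ε) = ε` (sharp: fails at the successor of `α`, cell check).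
[cite: DedinechinEtAl2013, Table I] -/
theorem rn_sinh_tiny (hRN : IsRoundNearest 53 RN) {ε : ℝ} (hε : IsFloat 53 ε) (hα : |ε| ≤ alpha) :
    RN (Real.sinh ε) = ε := by
  rcases lt_trichotomy ε 0 with hneg | hzero | hpos
  · have h := rn_sinh_tiny_pos hRN.mirror hε.neg (neg_pos.2 hneg) (by rwa [abs_of_neg hneg] at hα)
    simp only [Real.sinh_neg, neg_neg] at h
    linarith
  · subst hzero
    rw [Real.sinh_zero]
    have h0 := hRN.nearest 0 0 ⟨0, 0, by norm_num, by simp⟩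
    simp only [sub_zero, sub_self, abs_zero] at h0
    exact abs_nonpos_iff.1 h0
  · exact rn_sinh_tiny_pos hRN hε hpos (by rwa [abs_of_pos hpos] at hα)

end SinhRow

/-! ### The corrected η rows: generic rounding lemmas for the `x³/3` functions below `β₆ = 8183583624766078·2^−79` -/

section Corrected

variable {RN : ℝ → ℝ}

/-- The corrected bound of the η rows: `β₆ = 8183583624766078 · 2^−79 ≈ 6^{1/3}·2^−27 ≈ 0.9086·2^−26`
(the last float of the binade `[2^−27, 2^−26)` at which `tan`/`atanh` still round back to the argument;
the cell's numerical check — two implementations — shows `tanh`/`arctan` survive one float further).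
[cite: DedinechinEtAl2013, Table I] -/
noncomputable def beta6 : ℝ := 8183583624766078 / 2 ^ 79

/-- Unfolding `beta6`. [cite: DedinechinEtAl2013, Table I] -/
theorem beta6_eq : beta6 = 8183583624766078 / 2 ^ 79 := rfl

/-- INNER side, coefficient `1/3`: if `0 < ε ≤ β₆` is a float and `ε − ε³/3 ≤ f ε < ε`, then `RN(f ε) = ε`
for every round-to-nearest (`ε³/3 < ½ulp(ε)`, resp. `< ¼ulp` at a power of two, in every binade
`e ≤ −27`; the top binade by `β₆³ < 3·2^−80`). [cite: DedinechinEtAl2013, Table I] -/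
theorem rn_eq_of_inner_third (hRN : IsRoundNearest 53 RN) {f : ℝ → ℝ} {ε : ℝ} (hε : IsFloat 53 ε)
    (h0 : 0 < ε) (hβ : ε ≤ beta6) (hf1 : f ε < ε) (hf2 : ε - ε ^ 3 / 3 ≤ f ε) : RN (f ε) = ε := by
  obtain ⟨e, he1, he2⟩ := exists_binade h0
  have hβ26 : beta6 < (2 : ℝ) ^ (-26 : ℤ) := by rw [beta6_eq]; norm_num
  have he27 : e ≤ -27 := by
    have h1 : (2 : ℝ) ^ e < (2 : ℝ) ^ (-26 : ℤ) := lt_of_le_of_lt he1 (lt_of_le_of_lt hβ hβ26)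
    have := (zpow_lt_zpow_iff_right₀ (by norm_num : (1 : ℝ) < 2)).1 h1
    omega
  have hU : (0 : ℝ) < (2 : ℝ) ^ (e - 53) := by positivity
  rcases he1.lt_or_eq with hne | heq
  · apply rn_eq_of_abs_sub_lt_53 hRN hε hne
    rw [abs_of_pos (by linarith)]
    have key : ε ^ 3 / 3 < (2 : ℝ) ^ (e - 53) := by
      rcases (show e = -27 ∨ e ≤ -28 by omega) with h27 | h28
      · subst h27
        have h3 : ε ^ 3 ≤ beta6 ^ 3 := pow_le_pow_left₀ h0.le hβ 3
        rw [beta6_eq] at h3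
        have hnum : ((8183583624766078 / 2 ^ 79 : ℝ)) ^ 3 / 3 < (2 : ℝ) ^ ((-27 : ℤ) - 53) := by
          norm_num
        linarith
      · have h3 : ε ^ 3 < ((2 : ℝ) ^ (e + 1)) ^ 3 := pow_lt_pow_left₀ he2 h0.le (by norm_num)
        have hsplit : ((2 : ℝ) ^ (e + 1)) ^ 3 = (2 : ℝ) ^ (e - 53) * (2 : ℝ) ^ (2 * e + 56) := by
          rw [← zpow_natCast, ← zpow_mul, ← zpow_add₀ (by norm_num)]; congr 1; push_cast; ring
        have hsmall : (2 : ℝ) ^ (2 * e + 56) ≤ (2 : ℝ) ^ (0 : ℤ) :=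
          zpow_le_zpow_right₀ (by norm_num) (by omega)
        rw [zpow_zero] at hsmall
        have := mul_le_mul_of_nonneg_left hsmall hU.le
        rw [← hsplit] at this
        linarith
    linarith
  · rw [← heq] at hf1 hf2 ⊢
    apply rn_eq_two_zpow_53 hRN
    · have hsplit : ((2 : ℝ) ^ e) ^ 3 = (2 : ℝ) ^ (e - 54) * (2 : ℝ) ^ (2 * e + 54) := by
        rw [← zpow_natCast, ← zpow_mul, ← zpow_add₀ (by norm_num)]; congr 1; push_cast; ring
      have hsmall : (2 : ℝ) ^ (2 * e + 54) ≤ (2 : ℝ) ^ (0 : ℤ) :=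
        zpow_le_zpow_right₀ (by norm_num) (by omega)
      rw [zpow_zero] at hsmall
      have hV : (0 : ℝ) < (2 : ℝ) ^ (e - 54) := by positivity
      have := mul_le_mul_of_nonneg_left hsmall hV.le
      rw [← hsplit] at this
      linarith
    · have hV : (0 : ℝ) < (2 : ℝ) ^ (e - 53) := by positivity
      linarith

/-- OUTER side, coefficient `1/3`: if `0 < ε ≤ β₆` is a float and `ε ≤ f ε ≤ ε + ε³/3 + ε⁵/2`, then
`RN(f ε) = ε` for every round-to-nearest (the gap above a float is a full ulp, also at powers of two; top
binade: `β₆³/3 + β₆⁵/2 < 2^−80`, sharp). [cite: DedinechinEtAl2013, Table I] -/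
theorem rn_eq_of_outer_third (hRN : IsRoundNearest 53 RN) {f : ℝ → ℝ} {ε : ℝ} (hε : IsFloat 53 ε)
    (h0 : 0 < ε) (hβ : ε ≤ beta6) (hf1 : ε ≤ f ε) (hf2 : f ε ≤ ε + ε ^ 3 / 3 + ε ^ 5 / 2) :
    RN (f ε) = ε := by
  obtain ⟨e, he1, he2⟩ := exists_binade h0
  have hβ26 : beta6 < (2 : ℝ) ^ (-26 : ℤ) := by rw [beta6_eq]; norm_num
  have hβ1 : beta6 ≤ 1 := by rw [beta6_eq]; norm_num
  have he27 : e ≤ -27 := by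
    have h1 : (2 : ℝ) ^ e < (2 : ℝ) ^ (-26 : ℤ) := lt_of_le_of_lt he1 (lt_of_le_of_lt hβ hβ26)
    have := (zpow_lt_zpow_iff_right₀ (by norm_num : (1 : ℝ) < 2)).1 h1
    omega
  have hU : (0 : ℝ) < (2 : ℝ) ^ (e - 53) := by positivity
  have key : ε ^ 3 / 3 + ε ^ 5 / 2 < (2 : ℝ) ^ (e - 53) := by
    rcases (show e = -27 ∨ e ≤ -28 by omega) with h27 | h28
    · subst h27
      have h3 : ε ^ 3 ≤ beta6 ^ 3 := pow_le_pow_left₀ h0.le hβ 3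
      have h5 : ε ^ 5 ≤ beta6 ^ 5 := pow_le_pow_left₀ h0.le hβ 5
      rw [beta6_eq] at h3 h5
      have hnum : ((8183583624766078 / 2 ^ 79 : ℝ)) ^ 3 / 3 + ((8183583624766078 / 2 ^ 79 : ℝ)) ^ 5 / 2
          < (2 : ℝ) ^ ((-27 : ℤ) - 53) := by
        norm_num
      linarith
    · have h3 : ε ^ 3 < ((2 : ℝ) ^ (e + 1)) ^ 3 := pow_lt_pow_left₀ he2 h0.le (by norm_num)
      have h5 : ε ^ 5 ≤ ε ^ 3 := pow_le_pow_of_le_one h0.le (hβ.trans hβ1) (by norm_num)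
      have hsplit : ((2 : ℝ) ^ (e + 1)) ^ 3 = (2 : ℝ) ^ (e - 53) * (2 : ℝ) ^ (2 * e + 56) := by
        rw [← zpow_natCast, ← zpow_mul, ← zpow_add₀ (by norm_num)]; congr 1; push_cast; ring
      have hsmall : (2 : ℝ) ^ (2 * e + 56) ≤ (2 : ℝ) ^ (0 : ℤ) :=
        zpow_le_zpow_right₀ (by norm_num) (by omega)
      rw [zpow_zero] at hsmall
      have := mul_le_mul_of_nonneg_left hsmall hU.le
      rw [← hsplit] at this
      nlinarith
  rcases he1.lt_or_eq with hne | heq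
  · apply rn_eq_of_abs_sub_lt_53 hRN hε hne
    rw [abs_of_nonpos (by linarith)]
    linarith
  · rw [← heq] at hf1 hf2 key ⊢
    have hV : (0 : ℝ) < (2 : ℝ) ^ (e - 54) := by positivity
    exact rn_eq_two_zpow_53 hRN (by linarith) (by linarith)

/-- Mirror trick for odd functions: if the positive case holds for every round-to-nearest, the negative
case follows (the float grid is symmetric; `IsRoundNearest.mirror`). [cite: DedinechinEtAl2013, §1.4] -/
theorem rn_odd_of_pos {f : ℝ → ℝ} (hodd : ∀ x, f (-x) = -f x) {P : ℝ → Prop}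
    (hpos : ∀ (RN : ℝ → ℝ), IsRoundNearest 53 RN → ∀ ε, IsFloat 53 ε → 0 < ε → P ε → RN (f ε) = ε)
    (hRN : IsRoundNearest 53 RN) {ε : ℝ} (hε : IsFloat 53 ε) (hneg : ε < 0) (hP : P (-ε)) :
    RN (f ε) = ε := by
  have h := hpos _ hRN.mirror (-ε) hε.neg (neg_pos.2 hneg) hP
  simp only [hodd, neg_neg] at h
  linarith

end Corrected

/-! ### `arctan`: the corrected row `|ε| ≤ β₆` -/

section ArctanRow

variable {RN : ℝ → ℝ}

/-- `x − x³/3 < arctan x` for `x > 0` (derivative `x⁴/(1+x²) > 0`). [cite: DedinechinEtAl2013, Table I] -/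
theorem sub_cube_div_three_lt_arctan {x : ℝ} (hx : 0 < x) : x - x ^ 3 / 3 < Real.arctan x := by
  let f (t : ℝ) : ℝ := Real.arctan t - (t - t ^ 3 / 3)
  have hd : ∀ t, HasDerivAt f (t ^ 4 / (1 + t ^ 2)) t := fun t => by
    have h1 : (0 : ℝ) < 1 + t ^ 2 := by positivity
    have h : HasDerivAt (fun y => Real.arctan y - (y - y ^ 3 / 3))
        (1 / (1 + t ^ 2) - (1 - ↑(3 : ℕ) * t ^ (3 - 1) / 3)) t :=
      (Real.hasDerivAt_arctan t).sub ((hasDerivAt_id' t).sub ((hasDerivAt_pow 3 t).div_const 3))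
    refine h.congr_deriv ?_
    rw [eq_div_iff h1.ne']
    field_simp
    ring
  have hmono : StrictMonoOn f (Set.Ici 0) := by
    apply strictMonoOn_of_deriv_pos (convex_Ici 0)
      (fun t _ => (hd t).continuousAt.continuousWithinAt)
    intro t ht
    rw [interior_Ici] at ht
    rw [(hd t).deriv]
    have : (0 : ℝ) < t := ht
    positivity
  have h0 : f 0 < f x := hmono (by simp) hx.le hx
  simp only [f, Real.arctan_zero] at h0
  linarith

/-- **Corrected row `arctan`:** for every precision-53 float `ε` with `|ε| ≤ β₆ = 8183583624766078·2^−79`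
and every round-to-nearest, `RN(arctan ε) = ε`. (The printed `|ε| ≤ η` is false, `rn_arctan_two_zpow_neg26`;
numerically the sharp convex range is one float wider, `|ε| ≤ 8183583624766079·2^−79`, which needs the
quintic term.) [cite: DedinechinEtAl2013, Table I] -/
theorem rn_arctan_tiny (hRN : IsRoundNearest 53 RN) {ε : ℝ} (hε : IsFloat 53 ε) (hβ : |ε| ≤ beta6) :
    RN (Real.arctan ε) = ε := by
  have hpos : ∀ (RN : ℝ → ℝ), IsRoundNearest 53 RN → ∀ ε, IsFloat 53 ε → 0 < ε → ε ≤ beta6 →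
      RN (Real.arctan ε) = ε := by
    intro RN hRN ε hε h0 hb
    have hb1 : ε < Real.pi / 2 := by
      have := Real.pi_gt_three; rw [beta6_eq] at hb; norm_num at hb; linarith
    exact rn_eq_of_inner_third hRN hε h0 hb
      (by have := Real.lt_tan h0 hb1
          calc Real.arctan ε < Real.arctan (Real.tan ε) := Real.arctan_strictMono this
            _ = ε := Real.arctan_tan (by linarith) hb1)
      (sub_cube_div_three_lt_arctan h0).le
  rcases lt_trichotomy ε 0 with hneg | hzero | hp
  · exact rn_odd_of_pos Real.arctan_neg hpos hRN hε hneg (by rwa [abs_of_neg hneg] at hβ)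
  · subst hzero
    rw [Real.arctan_zero]
    have h0 := hRN.nearest 0 0 ⟨0, 0, by norm_num, by simp⟩
    simp only [sub_zero, sub_self, abs_zero] at h0
    exact abs_nonpos_iff.1 h0
  · exact hpos RN hRN ε hε hp (by rwa [abs_of_pos hp] at hβ)

end ArctanRow

/-! ### `tanh`: the corrected row `|ε| ≤ β₆` -/

section TanhRow

variable {RN : ℝ → ℝ}

/-- Five-term Taylor enclosures of `sinh` and `cosh` on `[0, 1]` (Mathlib `Real.exp_bound`).
[cite: DedinechinEtAl2013, Table I] -/
theorem sinh_cosh_bounds {x : ℝ} (hx0 : 0 ≤ x) (hx1 : x ≤ 1) :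
    x + x ^ 3 / 6 - x ^ 5 / 100 ≤ Real.sinh x ∧ Real.sinh x ≤ x + x ^ 3 / 6 + x ^ 5 / 100 ∧
    1 + x ^ 2 / 2 + x ^ 4 / 24 - x ^ 5 / 100 ≤ Real.cosh x ∧
      Real.cosh x ≤ 1 + x ^ 2 / 2 + x ^ 4 / 24 + x ^ 5 / 100 := by
  have hxa : |x| ≤ 1 := by rw [abs_of_nonneg hx0]; exact hx1
  have hxa' : |-x| ≤ 1 := by rw [abs_neg]; exact hxa
  have h1 := Real.exp_bound hxa (show 0 < 5 by norm_num)
  have h2 := Real.exp_bound hxa' (show 0 < 5 by norm_num)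
  rw [abs_of_nonneg hx0] at h1
  rw [abs_neg, abs_of_nonneg hx0] at h2
  obtain ⟨a1, a2⟩ := abs_sub_le_iff.1 h1
  obtain ⟨b1, b2⟩ := abs_sub_le_iff.1 h2
  simp only [Finset.sum_range_succ, Finset.sum_range_zero, Nat.factorial] at a1 a2 b1 b2
  norm_num at a1 a2 b1 b2
  rw [Real.sinh_eq, Real.cosh_eq]
  refine ⟨by linarith, by linarith, by linarith, by linarith⟩

/-- `x − x³/3 ≤ tanh x < x` for `0 < x ≤ 1`. [cite: DedinechinEtAl2013, Table I] -/
theorem tanh_bounds {x : ℝ} (hx0 : 0 < x) (hx1 : x ≤ 1) :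
    x - x ^ 3 / 3 ≤ Real.tanh x ∧ Real.tanh x < x := by
  obtain ⟨s1, s2, c1, c2⟩ := sinh_cosh_bounds hx0.le hx1
  have hc : 0 < Real.cosh x := Real.cosh_pos x
  rw [Real.tanh_eq_sinh_div_cosh]
  have hx5 : x ^ 5 ≤ x ^ 3 := pow_le_pow_of_le_one hx0.le hx1 (by norm_num)
  have hx6 : x ^ 6 ≤ x ^ 5 := pow_le_pow_of_le_one hx0.le hx1 (by norm_num)
  have hx7 : x ^ 7 ≤ x ^ 5 := pow_le_pow_of_le_one hx0.le hx1 (by norm_num)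
  have hx8 : x ^ 8 ≤ x ^ 5 := pow_le_pow_of_le_one hx0.le hx1 (by norm_num)
  have hp3 : 0 < x ^ 3 := by positivity
  have hp5 : 0 ≤ x ^ 5 := by positivity
  constructor
  · rw [le_div_iff₀ hc]
    have hT : 0 ≤ x - x ^ 3 / 3 := by nlinarith
    have h1 : (x - x ^ 3 / 3) * Real.cosh x ≤ (x - x ^ 3 / 3) * (1 + x ^ 2 / 2 + x ^ 4 / 24 + x ^ 5 / 100) :=
      mul_le_mul_of_nonneg_left c2 hT
    have h2 : (x - x ^ 3 / 3) * (1 + x ^ 2 / 2 + x ^ 4 / 24 + x ^ 5 / 100)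
        = x + x ^ 3 / 6 - x ^ 5 / 8 + x ^ 6 / 100 - x ^ 7 / 72 - x ^ 8 / 300 := by ring
    nlinarith
  · rw [div_lt_iff₀ hc]
    have h1 : x * (1 + x ^ 2 / 2 + x ^ 4 / 24 - x ^ 5 / 100) ≤ x * Real.cosh x :=
      mul_le_mul_of_nonneg_left c1 hx0.le
    have h2 : x * (1 + x ^ 2 / 2 + x ^ 4 / 24 - x ^ 5 / 100)
        = x + x ^ 3 / 2 + x ^ 5 / 24 - x ^ 6 / 100 := by ring
    nlinarith

/-- **Corrected row `tanh`:** for every precision-53 float `ε` with `|ε| ≤ β₆` and every round-to-nearest,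
`RN(tanh ε) = ε` (the printed `|ε| ≤ η` is false, `rn_tanh_two_zpow_neg26`; numerically the sharp range
is one float wider). [cite: DedinechinEtAl2013, Table I] -/
theorem rn_tanh_tiny (hRN : IsRoundNearest 53 RN) {ε : ℝ} (hε : IsFloat 53 ε) (hβ : |ε| ≤ beta6) :
    RN (Real.tanh ε) = ε := by
  have hpos : ∀ (RN : ℝ → ℝ), IsRoundNearest 53 RN → ∀ ε, IsFloat 53 ε → 0 < ε → ε ≤ beta6 →
      RN (Real.tanh ε) = ε := by
    intro RN hRN ε hε h0 hb
    have hb1 : ε ≤ 1 := hb.trans (by rw [beta6_eq]; norm_num)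
    obtain ⟨t1, t2⟩ := tanh_bounds h0 hb1
    exact rn_eq_of_inner_third hRN hε h0 hb t2 t1
  rcases lt_trichotomy ε 0 with hneg | hzero | hp
  · exact rn_odd_of_pos Real.tanh_neg hpos hRN hε hneg (by rwa [abs_of_neg hneg] at hβ)
  · subst hzero
    rw [Real.tanh_zero]
    have h0 := hRN.nearest 0 0 ⟨0, 0, by norm_num, by simp⟩
    simp only [sub_zero, sub_self, abs_zero] at h0
    exact abs_nonpos_iff.1 h0
  · exact hpos RN hRN ε hε hp (by rwa [abs_of_pos hp] at hβ)

end TanhRow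

/-! ### `atanh`: the corrected row `|ε| ≤ β₆` -/

section ArtanhRow

variable {RN : ℝ → ℝ}

/-- `x ≤ atanh x ≤ x + x³/3 + x⁵/2` for `0 < x ≤ 1/8` (logarithm series to five terms, Mathlib
`Real.abs_log_sub_add_sum_range_le`). [cite: DedinechinEtAl2013, Table I] -/
theorem artanh_bounds {x : ℝ} (hx0 : 0 < x) (hx1 : x ≤ 1 / 8) :
    x ≤ Real.artanh x ∧ Real.artanh x ≤ x + x ^ 3 / 3 + x ^ 5 / 2 := by
  have hart : Real.artanh x = 1 / 2 * (Real.log (1 + x) - Real.log (1 - x)) := by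
    rw [Real.artanh_eq_half_log ⟨by linarith, by linarith⟩, Real.log_div (by linarith) (by linarith)]
  have hl1 := Real.abs_log_sub_add_sum_range_le (x := x) (by rw [abs_of_pos hx0]; linarith) 5
  have hl2 := Real.abs_log_sub_add_sum_range_le (x := -x) (by rw [abs_neg, abs_of_pos hx0]; linarith) 5
  rw [abs_of_pos hx0] at hl1
  rw [abs_neg, abs_of_pos hx0, sub_neg_eq_add] at hl2
  have hden : 0 < 1 - x := by linarith
  obtain ⟨a1, a2⟩ := abs_le.1 hl1
  obtain ⟨b1, b2⟩ := abs_le.1 hl2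
  simp only [Finset.sum_range_succ, Finset.sum_range_zero] at a1 a2 b1 b2
  norm_num [neg_pow] at a1 a2 b1 b2
  have hE : x ^ 6 / (1 - x) ≤ 2 * x ^ 6 := by
    rw [div_le_iff₀ hden]; nlinarith [pow_nonneg hx0.le 6]
  have hx6 : x ^ 6 ≤ x ^ 5 / 8 := by
    have : x ^ 6 = x ^ 5 * x := by ring
    rw [this]; nlinarith [pow_nonneg hx0.le 5]
  have hp3 : 0 ≤ x ^ 3 := by positivity
  have hp5 : 0 ≤ x ^ 5 := by positivity
  have hx53 : x ^ 5 ≤ x ^ 3 := pow_le_pow_of_le_one hx0.le (by linarith) (by norm_num)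
  rw [hart]
  constructor
  · linarith
  · linarith

/-- **Corrected row `atanh`:** for every precision-53 float `ε` with `|ε| ≤ β₆ = 8183583624766078·2^−79`
and every round-to-nearest, `RN(atanh ε) = ε`; `β₆` is sharp (the cell's two implementations: the next
float fails), and the printed `|ε| < η` is false (`rn_artanh_pred_two_zpow_neg26`).
[cite: DedinechinEtAl2013, Table I] -/
theorem rn_artanh_tiny (hRN : IsRoundNearest 53 RN) {ε : ℝ} (hε : IsFloat 53 ε) (hβ : |ε| ≤ beta6) :
    RN (Real.artanh ε) = ε := by
  have hpos : ∀ (RN : ℝ → ℝ), IsRoundNearest 53 RN → ∀ ε, IsFloat 53 ε → 0 < ε → ε ≤ beta6 →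
      RN (Real.artanh ε) = ε := by
    intro RN hRN ε hε h0 hb
    have hb1 : ε ≤ 1 / 8 := hb.trans (by rw [beta6_eq]; norm_num)
    obtain ⟨t1, t2⟩ := artanh_bounds h0 hb1
    exact rn_eq_of_outer_third hRN hε h0 hb t1 t2
  have hodd : ∀ x, Real.artanh (-x) = -Real.artanh x := by
    intro x
    simp only [Real.artanh]
    rw [← Real.log_inv]
    congr 1
    rw [← Real.sqrt_inv, inv_div]
    ring_nf
  rcases lt_trichotomy ε 0 with hneg | hzero | hp
  · exact rn_odd_of_pos hodd hpos hRN hε hneg (by rwa [abs_of_neg hneg] at hβ)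
  · subst hzero
    rw [Real.artanh_zero]
    have h0 := hRN.nearest 0 0 ⟨0, 0, by norm_num, by simp⟩
    simp only [sub_zero, sub_self, abs_zero] at h0
    exact abs_nonpos_iff.1 h0
  · exact hpos RN hRN ε hε hp (by rwa [abs_of_pos hp] at hβ)

end ArtanhRow

/-! ### `asinh`: the printed row `|ε| ≤ α` confirmed -/

section ArsinhRow

variable {RN : ℝ → ℝ}

/-- INNER side, coefficient `1/6` (as for `sin`): if `0 < ε ≤ α` is a float and `ε − ε³/6 ≤ f ε < ε`,
then `RN(f ε) = ε` for every round-to-nearest. [cite: DedinechinEtAl2013, Table I] -/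
theorem rn_eq_of_inner_sixth (hRN : IsRoundNearest 53 RN) {f : ℝ → ℝ} {ε : ℝ} (hε : IsFloat 53 ε)
    (h0 : 0 < ε) (hα : ε ≤ alpha) (hf1 : f ε < ε) (hf2 : ε - ε ^ 3 / 6 ≤ f ε) : RN (f ε) = ε := by
  obtain ⟨e, he1, he2⟩ := exists_binade h0
  have hα25 : alpha < (2 : ℝ) ^ (-25 : ℤ) := by rw [alpha_eq]; norm_num
  have he26 : e ≤ -26 := by
    have h1 : (2 : ℝ) ^ e < (2 : ℝ) ^ (-25 : ℤ) := lt_of_le_of_lt he1 (lt_of_le_of_lt hα hα25)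
    have := (zpow_lt_zpow_iff_right₀ (by norm_num : (1 : ℝ) < 2)).1 h1
    omega
  have hU : (0 : ℝ) < (2 : ℝ) ^ (e - 53) := by positivity
  rcases he1.lt_or_eq with hne | heq
  · apply rn_eq_of_abs_sub_lt_53 hRN hε hne
    rw [abs_of_pos (by linarith)]
    have key : ε ^ 3 / 6 < (2 : ℝ) ^ (e - 53) := by
      rcases (show e = -26 ∨ e ≤ -27 by omega) with h26 | h27
      · subst h26
        have h3 : ε ^ 3 ≤ alpha ^ 3 := pow_le_pow_left₀ h0.le hα 3
        rw [alpha_eq] at h3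
        have hnum : ((6495314627411702 / 2 ^ 78 : ℝ)) ^ 3 / 6 < (2 : ℝ) ^ ((-26 : ℤ) - 53) := by
          norm_num
        linarith
      · have h3 : ε ^ 3 < ((2 : ℝ) ^ (e + 1)) ^ 3 := pow_lt_pow_left₀ he2 h0.le (by norm_num)
        have hsplit : ((2 : ℝ) ^ (e + 1)) ^ 3 = (2 : ℝ) ^ (e - 53) * (2 : ℝ) ^ (2 * e + 56) := by
          rw [← zpow_natCast, ← zpow_mul, ← zpow_add₀ (by norm_num)]; congr 1; push_cast; ring
        have hsmall : (2 : ℝ) ^ (2 * e + 56) ≤ (2 : ℝ) ^ (2 : ℤ) :=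
          zpow_le_zpow_right₀ (by norm_num) (by omega)
        have h22 : (2 : ℝ) ^ (2 : ℤ) = 4 := by norm_num
        rw [h22] at hsmall
        have := mul_le_mul_of_nonneg_left hsmall hU.le
        rw [← hsplit] at this
        linarith
    linarith
  · rw [← heq] at hf1 hf2 ⊢
    apply rn_eq_two_zpow_53 hRN
    · have hsplit : ((2 : ℝ) ^ e) ^ 3 = (2 : ℝ) ^ (e - 54) * (2 : ℝ) ^ (2 * e + 54) := by
        rw [← zpow_natCast, ← zpow_mul, ← zpow_add₀ (by norm_num)]; congr 1; push_cast; ring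
      have hsmall : (2 : ℝ) ^ (2 * e + 54) ≤ (2 : ℝ) ^ (2 : ℤ) :=
        zpow_le_zpow_right₀ (by norm_num) (by omega)
      have h22 : (2 : ℝ) ^ (2 : ℤ) = 4 := by norm_num
      rw [h22] at hsmall
      have hV : (0 : ℝ) < (2 : ℝ) ^ (e - 54) := by positivity
      have := mul_le_mul_of_nonneg_left hsmall hV.le
      rw [← hsplit] at this
      linarith
    · have hV : (0 : ℝ) < (2 : ℝ) ^ (e - 53) := by positivity
      linarith

/-- `x − x³/6 ≤ asinh x < x` for `0 < x ≤ 1` (through `sinh`: `sinh(x − x³/6) ≤ x < sinh x`, five-term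
exponential bounds). [cite: DedinechinEtAl2013, Table I] -/
theorem arsinh_bounds {x : ℝ} (hx0 : 0 < x) (hx1 : x ≤ 1) :
    x - x ^ 3 / 6 ≤ Real.arsinh x ∧ Real.arsinh x < x := by
  constructor
  · rw [← Real.sinh_le_sinh, Real.sinh_arsinh]
    set y := x - x ^ 3 / 6 with hy
    have hx3 : x ^ 3 ≤ x := by
      have := pow_le_pow_of_le_one hx0.le hx1 (show 1 ≤ 3 by norm_num); simpa using this
    have hy0 : 0 ≤ y := by rw [hy]; nlinarith
    have hyx : y ≤ x := by rw [hy]; nlinarith [pow_pos hx0 3]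
    obtain ⟨-, s2, -, -⟩ := sinh_cosh_bounds hy0 (hyx.trans hx1)
    have hy3 : y ^ 3 = x ^ 3 - x ^ 5 / 2 + x ^ 7 / 12 - x ^ 9 / 216 := by rw [hy]; ring
    have hy5 : y ^ 5 ≤ x ^ 5 := pow_le_pow_left₀ hy0 hyx 5
    have hx7 : x ^ 7 ≤ x ^ 5 := pow_le_pow_of_le_one hx0.le hx1 (by norm_num)
    have hp9 : 0 ≤ x ^ 9 := by positivity
    have hp5 : 0 ≤ x ^ 5 := by positivity
    rw [hy3] at s2
    rw [hy] at s2 ⊢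
    nlinarith
  · rw [← Real.sinh_lt_sinh, Real.sinh_arsinh]
    exact Real.self_lt_sinh_iff.2 hx0

/-- **Row `asinh` of Table I, CONFIRMED as a theorem:** for every precision-53 float `ε` with `|ε| ≤ α`
and every round-to-nearest, `RN(asinh ε) = ε` (sharp by the cell's check). [cite: DedinechinEtAl2013, Table I] -/
theorem rn_arsinh_tiny (hRN : IsRoundNearest 53 RN) {ε : ℝ} (hε : IsFloat 53 ε) (hα : |ε| ≤ alpha) :
    RN (Real.arsinh ε) = ε := by
  have hpos : ∀ (RN : ℝ → ℝ), IsRoundNearest 53 RN → ∀ ε, IsFloat 53 ε → 0 < ε → ε ≤ alpha →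
      RN (Real.arsinh ε) = ε := by
    intro RN hRN ε hε h0 hb
    have hb1 : ε ≤ 1 := hb.trans (by rw [alpha_eq]; norm_num)
    obtain ⟨t1, t2⟩ := arsinh_bounds h0 hb1
    exact rn_eq_of_inner_sixth hRN hε h0 hb t2 t1
  rcases lt_trichotomy ε 0 with hneg | hzero | hp
  · exact rn_odd_of_pos Real.arsinh_neg hpos hRN hε hneg (by rwa [abs_of_neg hneg] at hα)
  · subst hzero
    rw [Real.arsinh_zero]
    have h0 := hRN.nearest 0 0 ⟨0, 0, by norm_num, by simp⟩
    simp only [sub_zero, sub_self, abs_zero] at h0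
    exact abs_nonpos_iff.1 h0
  · exact hpos RN hRN ε hε hp (by rwa [abs_of_pos hp] at hα)

end ArsinhRow

/-! ### `tan`: the corrected row `|ε| ≤ β₆` -/

section TanRow

variable {RN : ℝ → ℝ}

open Literature.MathematicalPhysics.QuantumLattice.KLSNumerics in
/-- `x ≤ tan x ≤ x + x³/3 + x⁵/2` for `0 < x ≤ 1/2`, from the Taylor bounds `sin x ≤ x − x³/6 + x⁵/120`
and `1 − x²/2 + x⁴/24 − x⁶/720 ≤ cos x` already in the tree
(`Literature.MathematicalPhysics.QuantumLattice.KLSNumerics.sin_le_taylor_five` / `taylor_six_le_cos`)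
and Mathlib's `Real.le_tan`. [cite: DedinechinEtAl2013, Table I] -/
theorem tan_bounds {x : ℝ} (hx0 : 0 < x) (hx1 : x ≤ 1 / 2) :
    x ≤ Real.tan x ∧ Real.tan x ≤ x + x ^ 3 / 3 + x ^ 5 / 2 := by
  have hpi := Real.pi_gt_three
  have hx2 : x < Real.pi / 2 := by linarith
  refine ⟨Real.le_tan hx0.le hx2, ?_⟩
  have hs := sin_le_taylor_five hx0.le
  have hc := taylor_six_le_cos hx0.le
  have hC6 : 0 < 1 - x ^ 2 / 2 + x ^ 4 / 24 - x ^ 6 / 720 := by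
    have hx2' : x ^ 2 ≤ 1 / 4 := by nlinarith
    have hx6 : x ^ 6 ≤ 1 := pow_le_one₀ hx0.le (by linarith)
    have hp4 : 0 ≤ x ^ 4 := by positivity
    linarith
  have hcos : 0 < Real.cos x := lt_of_lt_of_le hC6 hc
  rw [Real.tan_eq_sin_div_cos, div_le_iff₀ hcos]
  have hT : 0 ≤ x + x ^ 3 / 3 + x ^ 5 / 2 := by positivity
  have h1 : (x + x ^ 3 / 3 + x ^ 5 / 2) * (1 - x ^ 2 / 2 + x ^ 4 / 24 - x ^ 6 / 720)
      ≤ (x + x ^ 3 / 3 + x ^ 5 / 2) * Real.cos x := mul_le_mul_of_nonneg_left hc hT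
  have h2 : (x + x ^ 3 / 3 + x ^ 5 / 2) * (1 - x ^ 2 / 2 + x ^ 4 / 24 - x ^ 6 / 720)
      - (x - x ^ 3 / 6 + x ^ 5 / 120)
      = x ^ 5 * (11 / 30) - x ^ 7 * (19 / 80) + x ^ 9 * (11 / 540) - x ^ 11 / 1440 := by ring
  have hx75 : x ^ 7 ≤ x ^ 5 := pow_le_pow_of_le_one hx0.le (by linarith) (by norm_num)
  have hx115 : x ^ 11 ≤ x ^ 5 := pow_le_pow_of_le_one hx0.le (by linarith) (by norm_num)
  have hp9 : 0 ≤ x ^ 9 := by positivity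
  have hp5 : 0 ≤ x ^ 5 := by positivity
  nlinarith

/-- **Corrected row `tan`:** for every precision-53 float `ε` with `|ε| ≤ β₆ = 8183583624766078·2^−79`
and every round-to-nearest, `RN(tan ε) = ε`; `β₆` is sharp (cell check: the next float fails), and the
printed `|ε| < η` is false (`rn_tan_pred_two_zpow_neg26`). [cite: DedinechinEtAl2013, Table I] -/
theorem rn_tan_tiny (hRN : IsRoundNearest 53 RN) {ε : ℝ} (hε : IsFloat 53 ε) (hβ : |ε| ≤ beta6) :
    RN (Real.tan ε) = ε := by
  have hpos : ∀ (RN : ℝ → ℝ), IsRoundNearest 53 RN → ∀ ε, IsFloat 53 ε → 0 < ε → ε ≤ beta6 →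
      RN (Real.tan ε) = ε := by
    intro RN hRN ε hε h0 hb
    have hb1 : ε ≤ 1 / 2 := hb.trans (by rw [beta6_eq]; norm_num)
    obtain ⟨t1, t2⟩ := tan_bounds h0 hb1
    exact rn_eq_of_outer_third hRN hε h0 hb t1 t2
  rcases lt_trichotomy ε 0 with hneg | hzero | hp
  · exact rn_odd_of_pos Real.tan_neg hpos hRN hε hneg (by rwa [abs_of_neg hneg] at hβ)
  · subst hzero
    rw [Real.tan_zero]
    have h0 := hRN.nearest 0 0 ⟨0, 0, by norm_num, by simp⟩
    simp only [sub_zero, sub_self, abs_zero] at h0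
    exact abs_nonpos_iff.1 h0
  · exact hpos RN hRN ε hε hp (by rwa [abs_of_pos hp] at hβ)

end TanRow

/-! ### The quadratic rows: `expm1(ε) → ε` and `log1p(ε) → ε` for `|ε| < RN(√2)·2^−53` -/

section QuadraticRows

variable {RN : ℝ → ℝ}

/-- `RN(√2) × 2^−53` of Table I as the exact dyadic `6369051672525773 · 2^−105`
(`RN(√2) = 6369051672525773·2^−52`, see `s2_isRN_sqrt2`). [cite: DedinechinEtAl2013, Table I] -/
noncomputable def s2 : ℝ := 6369051672525773 / 2 ^ 105

/-- Unfolding `s2`. [cite: DedinechinEtAl2013, Table I] -/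
theorem s2_eq : s2 = 6369051672525773 / 2 ^ 105 := rfl

/-- `6369051672525773·2^−52` is the binary64 number nearest to `√2` (`((2m−1)/2^53)² < 2 < ((2m+1)/2^53)²`,
`m` has 53 bits), so `s2 = RN(√2)·2^−53` as printed. [cite: DedinechinEtAl2013, Table I] -/
theorem s2_isRN_sqrt2 :
    (2 * 6369051672525773 - 1 : ℤ) ^ 2 < 2 * 2 ^ 106 ∧ 2 * 2 ^ 106 < (2 * 6369051672525773 + 1 : ℤ) ^ 2
      ∧ 2 ^ 52 ≤ (6369051672525773 : ℤ) ∧ (6369051672525773 : ℤ) < 2 ^ 53 := by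
  refine ⟨by norm_num, by norm_num, by norm_num, by norm_num⟩

/-- A positive float strictly below `s2` is at most its predecessor `6369051672525772·2^−105` (the floats
of the binade `[2^−53, 2^−52)` are the multiples of `2^−105`). [cite: DedinechinEtAl2013, §2.1.1] -/
theorem le_pred_s2_of_lt {ε : ℝ} (hε : IsFloat 53 ε) (h0 : 0 < ε) (h : ε < s2) :
    ε ≤ 6369051672525772 / 2 ^ 105 := by
  rcases lt_or_ge ε ((2 : ℝ) ^ (-53 : ℤ)) with hlt | hge
  · exact hlt.le.trans (by norm_num)
  · obtain ⟨K, hK⟩ := hε.exists_int_mul_of_le (e := -53) (by rw [abs_of_pos h0]; exact hge)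
    have hK' : (K : ℝ) < 6369051672525773 := by
      rw [hK, s2_eq] at h
      have h2 : (0 : ℝ) < (2 : ℝ) ^ ((-53 : ℤ) - (53 : ℕ) + 1) := by positivity
      have : (K : ℝ) * (2 : ℝ) ^ ((-53 : ℤ) - (53 : ℕ) + 1)
          < 6369051672525773 * (2 : ℝ) ^ ((-53 : ℤ) - (53 : ℕ) + 1) := by
        refine lt_of_lt_of_le h (le_of_eq ?_); norm_num
      exact lt_of_mul_lt_mul_right this h2.le
    have hKi : K ≤ 6369051672525772 := by
      have : K < 6369051672525773 := by exact_mod_cast hK'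
      omega
    have hKr : (K : ℝ) ≤ 6369051672525772 := by exact_mod_cast hKi
    rw [hK]
    have h2 : (0 : ℝ) ≤ (2 : ℝ) ^ ((-53 : ℤ) - (53 : ℕ) + 1) := by positivity
    calc (K : ℝ) * (2 : ℝ) ^ ((-53 : ℤ) - (53 : ℕ) + 1)
        ≤ 6369051672525772 * (2 : ℝ) ^ ((-53 : ℤ) - (53 : ℕ) + 1) := mul_le_mul_of_nonneg_right hKr h2
      _ = 6369051672525772 / 2 ^ 105 := by norm_num

/-- INNER side, quadratic rows: if `0 < ε < s2` is a float and `ε − ε²/2 < f ε < ε`, then `RN(f ε) = ε` for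
every round-to-nearest (`ε²/2 ≤ ½ulp` in the top binade `[2^−53, 2^−52)` because `ε ≤ pred(s2)` — sharp —,
`< ½ulp` below, and `= ¼ulp` exactly at powers of two, where the strict inequality decides).
[cite: DedinechinEtAl2013, Table I] -/
theorem rn_eq_of_inner_half (hRN : IsRoundNearest 53 RN) {f : ℝ → ℝ} {ε : ℝ} (hε : IsFloat 53 ε)
    (h0 : 0 < ε) (hs : ε < s2) (hf1 : f ε < ε) (hf2 : ε - ε ^ 2 / 2 < f ε) : RN (f ε) = ε := by
  have hb := le_pred_s2_of_lt hε h0 hs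
  obtain ⟨e, he1, he2⟩ := exists_binade h0
  have he53 : e ≤ -53 := by
    have h1 : (2 : ℝ) ^ e < (2 : ℝ) ^ (-52 : ℤ) := lt_of_le_of_lt he1 (lt_of_le_of_lt hb (by norm_num))
    have := (zpow_lt_zpow_iff_right₀ (by norm_num : (1 : ℝ) < 2)).1 h1
    omega
  have hU : (0 : ℝ) < (2 : ℝ) ^ (e - 53) := by positivity
  rcases he1.lt_or_eq with hne | heq
  · apply rn_eq_of_abs_sub_lt_53 hRN hε hne
    rw [abs_of_pos (by linarith)]
    have key : ε ^ 2 / 2 ≤ (2 : ℝ) ^ (e - 53) := by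
      rcases (show e = -53 ∨ e ≤ -54 by omega) with h53 | h54
      · subst h53
        have h3 : ε ^ 2 ≤ (6369051672525772 / 2 ^ 105 : ℝ) ^ 2 := pow_le_pow_left₀ h0.le hb 2
        have hnum : ((6369051672525772 / 2 ^ 105 : ℝ)) ^ 2 / 2 ≤ (2 : ℝ) ^ ((-53 : ℤ) - 53) := by
          norm_num
        linarith
      · have h3 : ε ^ 2 < ((2 : ℝ) ^ (e + 1)) ^ 2 := pow_lt_pow_left₀ he2 h0.le (by norm_num)
        have hsplit : ((2 : ℝ) ^ (e + 1)) ^ 2 = (2 : ℝ) ^ (e - 53) * (2 : ℝ) ^ (e + 55) := by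
          rw [← zpow_natCast, ← zpow_mul, ← zpow_add₀ (by norm_num)]; congr 1; push_cast; ring
        have hsmall : (2 : ℝ) ^ (e + 55) ≤ (2 : ℝ) ^ (1 : ℤ) :=
          zpow_le_zpow_right₀ (by norm_num) (by omega)
        rw [zpow_one] at hsmall
        have := mul_le_mul_of_nonneg_left hsmall hU.le
        rw [← hsplit] at this
        linarith
    linarith
  · rw [← heq] at hf1 hf2 ⊢
    apply rn_eq_two_zpow_53 hRN
    · have hsplit : ((2 : ℝ) ^ e) ^ 2 = (2 : ℝ) ^ (e - 54) * (2 : ℝ) ^ (e + 54) := by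
        rw [← zpow_natCast, ← zpow_mul, ← zpow_add₀ (by norm_num)]; congr 1; push_cast; ring
      have hsmall : (2 : ℝ) ^ (e + 54) ≤ (2 : ℝ) ^ (1 : ℤ) :=
        zpow_le_zpow_right₀ (by norm_num) (by omega)
      rw [zpow_one] at hsmall
      have hV : (0 : ℝ) < (2 : ℝ) ^ (e - 54) := by positivity
      have := mul_le_mul_of_nonneg_left hsmall hV.le
      rw [← hsplit] at this
      linarith
    · have hV : (0 : ℝ) < (2 : ℝ) ^ (e - 53) := by positivity
      linarith

/-- OUTER side, quadratic rows: if `0 < ε < s2` is a float and `ε ≤ f ε ≤ ε + ε²/2 + ε³/2`, then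
`RN(f ε) = ε` for every round-to-nearest (top binade: `ε ≤ pred(s2)`, sharp; binade `[2^−54, 2^−53)`: its
top float `2^−53 − 2^−106` passes by the margin `(4/5)·2^−159`; below: `ε² < ½ulp`).
[cite: DedinechinEtAl2013, Table I] -/
theorem rn_eq_of_outer_half (hRN : IsRoundNearest 53 RN) {f : ℝ → ℝ} {ε : ℝ} (hε : IsFloat 53 ε)
    (h0 : 0 < ε) (hs : ε < s2) (hf1 : ε ≤ f ε) (hf2 : f ε ≤ ε + ε ^ 2 / 2 + ε ^ 3 / 2) :
    RN (f ε) = ε := by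
  have hb := le_pred_s2_of_lt hε h0 hs
  obtain ⟨e, he1, he2⟩ := exists_binade h0
  have he53 : e ≤ -53 := by
    have h1 : (2 : ℝ) ^ e < (2 : ℝ) ^ (-52 : ℤ) := lt_of_le_of_lt he1 (lt_of_le_of_lt hb (by norm_num))
    have := (zpow_lt_zpow_iff_right₀ (by norm_num : (1 : ℝ) < 2)).1 h1
    omega
  have hU : (0 : ℝ) < (2 : ℝ) ^ (e - 53) := by positivity
  have hε1 : ε ≤ 1 := hb.trans (by norm_num)
  have key : ε ^ 2 / 2 + ε ^ 3 / 2 < (2 : ℝ) ^ (e - 53) := by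
    rcases (show e = -53 ∨ e = -54 ∨ e ≤ -55 by omega) with h53 | h54 | h55
    · subst h53
      have h2 : ε ^ 2 ≤ (6369051672525772 / 2 ^ 105 : ℝ) ^ 2 := pow_le_pow_left₀ h0.le hb 2
      have h3 : ε ^ 3 ≤ (6369051672525772 / 2 ^ 105 : ℝ) ^ 3 := pow_le_pow_left₀ h0.le hb 3
      have hnum : ((6369051672525772 / 2 ^ 105 : ℝ)) ^ 2 / 2 + ((6369051672525772 / 2 ^ 105 : ℝ)) ^ 3 / 2
          < (2 : ℝ) ^ ((-53 : ℤ) - 53) := by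
        norm_num
      linarith
    · subst h54
      -- the largest float of the binade is 2^-53 - 2^-106
      have htop : ε ≤ (2 : ℝ) ^ ((-54 : ℤ) + 1) - (2 : ℝ) ^ ((-54 : ℤ) + 1 - (53 : ℕ)) :=
        hε.le_sub_of_lt (by norm_num) he2
      have htop' : ε ≤ 1 / 2 ^ 53 - 1 / 2 ^ 106 := by
        refine htop.trans (le_of_eq ?_); norm_num
      have h2 : ε ^ 2 ≤ (1 / 2 ^ 53 - 1 / 2 ^ 106 : ℝ) ^ 2 := pow_le_pow_left₀ h0.le htop' 2
      have h3 : ε ^ 3 ≤ (1 / 2 ^ 53 - 1 / 2 ^ 106 : ℝ) ^ 3 := pow_le_pow_left₀ h0.le htop' 3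
      have hnum : ((1 / 2 ^ 53 - 1 / 2 ^ 106 : ℝ)) ^ 2 / 2 + ((1 / 2 ^ 53 - 1 / 2 ^ 106 : ℝ)) ^ 3 / 2
          < (2 : ℝ) ^ ((-54 : ℤ) - 53) := by
        norm_num
      linarith
    · have h2 : ε ^ 2 < ((2 : ℝ) ^ (e + 1)) ^ 2 := pow_lt_pow_left₀ he2 h0.le (by norm_num)
      have h3 : ε ^ 3 ≤ ε ^ 2 := pow_le_pow_of_le_one h0.le hε1 (by norm_num)
      have hsplit : ((2 : ℝ) ^ (e + 1)) ^ 2 = (2 : ℝ) ^ (e - 53) * (2 : ℝ) ^ (e + 55) := by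
        rw [← zpow_natCast, ← zpow_mul, ← zpow_add₀ (by norm_num)]; congr 1; push_cast; ring
      have hsmall : (2 : ℝ) ^ (e + 55) ≤ (2 : ℝ) ^ (0 : ℤ) :=
        zpow_le_zpow_right₀ (by norm_num) (by omega)
      rw [zpow_zero] at hsmall
      have := mul_le_mul_of_nonneg_left hsmall hU.le
      rw [← hsplit] at this
      linarith
  rcases he1.lt_or_eq with hne | heq
  · apply rn_eq_of_abs_sub_lt_53 hRN hε hne
    rw [abs_of_nonpos (by linarith)]
    linarith
  · rw [← heq] at hf1 hf2 key ⊢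
    have hV : (0 : ℝ) < (2 : ℝ) ^ (e - 54) := by positivity
    exact rn_eq_two_zpow_53 hRN (by linarith) (by linarith)

/-- **Row `expm1` (first line) of Table I, CONFIRMED as a theorem:** for every precision-53 float `ε` with
`|ε| < RN(√2)·2^−53` and every round-to-nearest, `RN(e^ε − 1) = ε`. Positive `ε`: outer side,
`e^ε − 1 − ε ≤ ε²/2 + (2/9)ε³` (Mathlib `Real.exp_bound`, three terms); negative `ε`: inner side, where at the
powers of two `−2^e` the deviation `ε²/2` equals the quarter-ulp exactly and the NEGATIVE cubic term
decides (`Real.exp_bound`, four terms) — sharp everywhere by the cell's check. [cite: DedinechinEtAl2013, Table I] -/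
theorem rn_expm1_tiny (hRN : IsRoundNearest 53 RN) {ε : ℝ} (hε : IsFloat 53 ε) (hs : |ε| < s2) :
    RN (Real.exp ε - 1) = ε := by
  have hs1 : s2 ≤ 1 := by rw [s2_eq]; norm_num
  rcases lt_trichotomy ε 0 with hneg | hzero | hpos
  · -- ε < 0: mirrored rounding t ↦ -RN(-t), argument x = -ε, reflected function x ↦ 1 - e^{-x} (inner side)
    rw [abs_of_neg hneg] at hs
    have hx0 : 0 < -ε := neg_pos.2 hneg
    have hxa : |ε| ≤ 1 := by rw [abs_of_neg hneg]; linarith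
    have hb := Real.exp_bound hxa (show 0 < 4 by norm_num)
    rw [abs_of_neg hneg] at hb
    obtain ⟨k1, k2⟩ := abs_sub_le_iff.1 hb
    simp only [Finset.sum_range_succ, Finset.sum_range_zero, Nat.factorial] at k1 k2
    norm_num at k1 k2
    have hlt := Real.add_one_lt_exp hneg.ne
    have hx3 : 0 < (-ε) ^ 3 := pow_pos hx0 3
    have hx4 : (-ε) ^ 4 ≤ (-ε) ^ 3 := pow_le_pow_of_le_one hx0.le (by linarith) (by norm_num)
    have e3 : (-ε) ^ 3 = -ε ^ 3 := by ring
    have e4 : (-ε) ^ 4 = ε ^ 4 := by ring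
    rw [e3] at hx3 hx4; rw [e4] at hx4
    have h1 : -(Real.exp (-(-ε)) - 1) < -ε := by rw [neg_neg]; linarith
    have h2 : -ε - (-ε) ^ 2 / 2 < -(Real.exp (-(-ε)) - 1) := by
      rw [neg_neg, show (-ε) ^ 2 = ε ^ 2 by ring]; nlinarith
    have key := rn_eq_of_inner_half hRN.mirror (f := fun x => -(Real.exp (-x) - 1)) hε.neg hx0 hs h1 h2
    simp only [neg_neg] at key
    linarith
  · subst hzero
    rw [Real.exp_zero, sub_self]
    have h0 := hRN.nearest 0 0 ⟨0, 0, by norm_num, by simp⟩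
    simp only [sub_zero, sub_self, abs_zero] at h0
    exact abs_nonpos_iff.1 h0
  · rw [abs_of_pos hpos] at hs
    have hxa : |ε| ≤ 1 := by rw [abs_of_pos hpos]; linarith
    have hb := Real.exp_bound hxa (show 0 < 3 by norm_num)
    rw [abs_of_pos hpos] at hb
    obtain ⟨k1, k2⟩ := abs_sub_le_iff.1 hb
    simp only [Finset.sum_range_succ, Finset.sum_range_zero, Nat.factorial] at k1 k2
    norm_num at k1 k2
    have hp3 : 0 ≤ ε ^ 3 := by positivity
    have h1 : ε ≤ Real.exp ε - 1 := by have := Real.add_one_le_exp ε; linarith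
    have h2 : Real.exp ε - 1 ≤ ε + ε ^ 2 / 2 + ε ^ 3 / 2 := by linarith
    exact rn_eq_of_outer_half hRN (f := fun x => Real.exp x - 1) hε hpos hs h1 h2

/-- **Row `log1p` of Table I, CONFIRMED as a theorem:** for every precision-53 float `ε` with
`|ε| < RN(√2)·2^−53` and every round-to-nearest, `RN(log(1 + ε)) = ε`. Positive `ε`: inner side (at the
power of two `2^−53` the deviation is the quarter-ulp exactly and the POSITIVE cubic term `ε³/3` decides);
negative `ε`: outer side, `|log(1+ε)| − |ε| ≤ ε²/2 + |ε|³/3 + ε⁴/(1−|ε|)` (Mathlib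
`Real.abs_log_sub_add_sum_range_le`, three terms). Sharp by the cell's check. [cite: DedinechinEtAl2013, Table I] -/
theorem rn_log1p_tiny (hRN : IsRoundNearest 53 RN) {ε : ℝ} (hε : IsFloat 53 ε) (hs : |ε| < s2) :
    RN (Real.log (1 + ε)) = ε := by
  have hs1 : s2 ≤ 1 / 8 := by rw [s2_eq]; norm_num
  rcases lt_trichotomy ε 0 with hneg | hzero | hpos
  · -- ε < 0: mirrored rounding, x = -ε, reflected function x ↦ -log(1 - x) (outer side)
    rw [abs_of_neg hneg] at hs
    have hx0 : 0 < -ε := neg_pos.2 hneg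
    have hx1 : -ε ≤ 1 / 8 := hs.le.trans hs1
    generalize hx : -ε = x at hx0 hx1 hs
    have hεx : ε = -x := by linarith
    subst hεx
    have hl := Real.abs_log_sub_add_sum_range_le (x := x) (by rw [abs_of_pos hx0]; linarith) 3
    rw [abs_of_pos hx0] at hl
    obtain ⟨a1, a2⟩ := abs_le.1 hl
    simp only [Finset.sum_range_succ, Finset.sum_range_zero] at a1 a2
    norm_num at a1 a2
    have hden : 0 < 1 - x := by linarith
    have hE : x ^ 4 / (1 - x) ≤ 8 / 7 * x ^ 4 := by
      rw [div_le_iff₀ hden]; nlinarith [pow_nonneg hx0.le 4]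
    have hx43 : x ^ 4 ≤ x ^ 3 / 8 := by
      have : x ^ 4 = x ^ 3 * x := by ring
      rw [this]; nlinarith [pow_nonneg hx0.le 3]
    have hlog_le : Real.log (1 - x) ≤ -x := by
      have := Real.log_le_sub_one_of_pos hden; linarith
    have h1 : x ≤ -Real.log (1 - x) := by linarith
    have h2 : -Real.log (1 - x) ≤ x + x ^ 2 / 2 + x ^ 3 / 2 := by linarith
    have hxf : IsFloat 53 x := by simpa using hε.neg
    have key := rn_eq_of_outer_half hRN.mirror (f := fun t => -Real.log (1 - t)) hxf hx0 hs h1 h2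
    simp only [neg_neg] at key
    rw [show (1 : ℝ) + -x = 1 - x by ring]
    linarith
  · subst hzero
    rw [add_zero, Real.log_one]
    have h0 := hRN.nearest 0 0 ⟨0, 0, by norm_num, by simp⟩
    simp only [sub_zero, sub_self, abs_zero] at h0
    exact abs_nonpos_iff.1 h0
  · rw [abs_of_pos hpos] at hs
    have hx1 : ε ≤ 1 / 8 := hs.le.trans hs1
    have hl := Real.abs_log_sub_add_sum_range_le (x := -ε) (by rw [abs_neg, abs_of_pos hpos]; linarith) 3
    rw [abs_neg, abs_of_pos hpos, sub_neg_eq_add] at hl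
    obtain ⟨a1, a2⟩ := abs_le.1 hl
    simp only [Finset.sum_range_succ, Finset.sum_range_zero] at a1 a2
    norm_num [neg_pow] at a1 a2
    have hden : 0 < 1 - ε := by linarith
    have hE : ε ^ 4 / (1 - ε) ≤ 2 * ε ^ 4 := by
      rw [div_le_iff₀ hden]; nlinarith [pow_nonneg hpos.le 4]
    have hx43 : ε ^ 4 ≤ ε ^ 3 / 8 := by
      have : ε ^ 4 = ε ^ 3 * ε := by ring
      rw [this]; nlinarith [pow_nonneg hpos.le 3]
    have hp3 : 0 < ε ^ 3 := pow_pos hpos 3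
    have h1 : Real.log (1 + ε) < ε := by
      have := Real.log_lt_sub_one_of_pos (by linarith : 0 < 1 + ε) (by linarith); linarith
    have h2 : ε - ε ^ 2 / 2 < Real.log (1 + ε) := by nlinarith
    exact rn_eq_of_inner_half hRN (f := fun x => Real.log (1 + x)) hε hpos hs h1 h2

end QuadraticRows

/-! ### `arcsin`: the printed row `|ε| < α` confirmed -/

section ArcsinRow

variable {RN : ℝ → ℝ}

/-- `x ≤ arcsin x ≤ x + x³/6 + x⁵/10` for `0 ≤ x ≤ 1/2` (the derivative `1/√(1−x²)` is at most
`1 + x²/2 + x⁴/2` there). [cite: DedinechinEtAl2013, Table I] -/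
theorem arcsin_bounds {x : ℝ} (hx0 : 0 ≤ x) (hx1 : x ≤ 1 / 2) :
    x ≤ Real.arcsin x ∧ Real.arcsin x ≤ x + x ^ 3 / 6 + x ^ 5 / 10 := by
  have hpi := Real.pi_gt_three
  constructor
  · have h := Real.arcsin_le_arcsin (Real.sin_le hx0)
    rwa [Real.arcsin_sin (by linarith) (by linarith)] at h
  · rcases hx0.eq_or_lt with h0 | h0
    · rw [← h0]; simp
    let f (t : ℝ) : ℝ := t + t ^ 3 / 6 + t ^ 5 / 10 - Real.arcsin t
    have hd : ∀ t ∈ Set.Ioo (0 : ℝ) (1 / 2),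
        HasDerivAt f (1 + t ^ 2 / 2 + t ^ 4 / 2 - 1 / Real.sqrt (1 - t ^ 2)) t := by
      intro t ht
      have h : HasDerivAt (fun y => y + y ^ 3 / 6 + y ^ 5 / 10 - Real.arcsin y)
          (1 + ↑(3 : ℕ) * t ^ (3 - 1) / 6 + ↑(5 : ℕ) * t ^ (5 - 1) / 10 - 1 / Real.sqrt (1 - t ^ 2)) t :=
        (((hasDerivAt_id' t).add ((hasDerivAt_pow 3 t).div_const 6)).add
          ((hasDerivAt_pow 5 t).div_const 10)).sub
          (Real.hasDerivAt_arcsin (by linarith [ht.1]) (by linarith [ht.2]))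
      refine h.congr_deriv ?_
      push_cast
      ring
    have hcont : ContinuousOn f (Set.Icc 0 (1 / 2)) := by
      have : ContinuousOn Real.arcsin (Set.Icc 0 (1 / 2)) := Real.continuous_arcsin.continuousOn
      fun_prop
    have hmono : StrictMonoOn f (Set.Icc 0 (1 / 2)) := by
      apply strictMonoOn_of_deriv_pos (convex_Icc 0 (1 / 2)) hcont
      intro t ht
      rw [interior_Icc] at ht
      rw [(hd t ht).deriv]
      -- 1/√(1 − t²) < 1 + t²/2 + t⁴/2  ⟸  1 < P²(1 − t²)
      have ht0 : 0 < t := ht.1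
      have ht1 : t < 1 / 2 := ht.2
      have hP : 0 < 1 + t ^ 2 / 2 + t ^ 4 / 2 := by positivity
      have hS : 0 < Real.sqrt (1 - t ^ 2) := Real.sqrt_pos.2 (by nlinarith)
      have hu : t ^ 2 ≤ 1 / 4 := by nlinarith
      have hkey : 1 < (1 + t ^ 2 / 2 + t ^ 4 / 2) ^ 2 * (1 - t ^ 2) := by
        have ht2 : 0 < t ^ 2 := by positivity
        have e : (1 + t ^ 2 / 2 + t ^ 4 / 2) ^ 2 * (1 - t ^ 2) - 1
            = (t ^ 2) ^ 2 * (1 / 4 - 3 / 4 * t ^ 2 - (t ^ 2) ^ 2 / 4 - (t ^ 2) ^ 3 / 4) := by ring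
        have hpos : 0 < (t ^ 2) ^ 2 * (1 / 4 - 3 / 4 * t ^ 2 - (t ^ 2) ^ 2 / 4 - (t ^ 2) ^ 3 / 4) := by
          apply mul_pos (by positivity)
          nlinarith
        linarith
      have hinv : 1 / (1 + t ^ 2 / 2 + t ^ 4 / 2) < Real.sqrt (1 - t ^ 2) := by
        rw [Real.lt_sqrt (by positivity), div_pow, one_pow, div_lt_iff₀ (by positivity)]
        linarith
      have := mul_lt_mul_of_pos_right hinv hP
      rw [one_div, inv_mul_cancel₀ hP.ne'] at this
      have h2 : 1 / Real.sqrt (1 - t ^ 2) < 1 + t ^ 2 / 2 + t ^ 4 / 2 := by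
        rw [div_lt_iff₀ hS]; linarith
      linarith
    have h0' : f 0 < f x := hmono (by simp) ⟨hx0, hx1⟩ h0
    simp only [f, Real.arcsin_zero] at h0'
    linarith

/-- A positive float strictly below `alpha` is at most its predecessor `6495314627411701·2^−78`.
[cite: DedinechinEtAl2013, §2.1.1] -/
theorem le_pred_alpha_of_lt {ε : ℝ} (hε : IsFloat 53 ε) (h0 : 0 < ε) (h : ε < alpha) :
    ε ≤ 6495314627411701 / 2 ^ 78 := by
  rcases lt_or_ge ε ((2 : ℝ) ^ (-26 : ℤ)) with hlt | hge
  · exact hlt.le.trans (by norm_num)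
  · obtain ⟨K, hK⟩ := hε.exists_int_mul_of_le (e := -26) (by rw [abs_of_pos h0]; exact hge)
    have h2 : (0 : ℝ) < (2 : ℝ) ^ ((-26 : ℤ) - (53 : ℕ) + 1) := by positivity
    have hK' : (K : ℝ) < 6495314627411702 := by
      rw [hK, alpha_eq] at h
      have : (K : ℝ) * (2 : ℝ) ^ ((-26 : ℤ) - (53 : ℕ) + 1)
          < 6495314627411702 * (2 : ℝ) ^ ((-26 : ℤ) - (53 : ℕ) + 1) := by
        refine lt_of_lt_of_le h (le_of_eq ?_); norm_num
      exact lt_of_mul_lt_mul_right this h2.le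
    have hKi : K ≤ 6495314627411701 := by
      have : K < 6495314627411702 := by exact_mod_cast hK'
      omega
    have hKr : (K : ℝ) ≤ 6495314627411701 := by exact_mod_cast hKi
    rw [hK]
    calc (K : ℝ) * (2 : ℝ) ^ ((-26 : ℤ) - (53 : ℕ) + 1)
        ≤ 6495314627411701 * (2 : ℝ) ^ ((-26 : ℤ) - (53 : ℕ) + 1) := mul_le_mul_of_nonneg_right hKr h2.le
      _ = 6495314627411701 / 2 ^ 78 := by norm_num

/-- OUTER side with the strict bound `ε < α` (i.e. `ε ≤ pred α`): if `ε ≤ f ε ≤ ε + ε³/6 + ε⁵/10` then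
`RN(f ε) = ε` for every round-to-nearest (top binade: `(pred α)³/6 + (pred α)⁵/10 < 2^−79`, sharp — at `α`
itself the row fails; binades below: `4 < 6`). [cite: DedinechinEtAl2013, Table I] -/
theorem rn_eq_of_outer_sixth_lt (hRN : IsRoundNearest 53 RN) {f : ℝ → ℝ} {ε : ℝ} (hε : IsFloat 53 ε)
    (h0 : 0 < ε) (hα : ε < alpha) (hf1 : ε ≤ f ε) (hf2 : f ε ≤ ε + ε ^ 3 / 6 + ε ^ 5 / 10) :
    RN (f ε) = ε := by
  have hb := le_pred_alpha_of_lt hε h0 hα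
  obtain ⟨e, he1, he2⟩ := exists_binade h0
  have he26 : e ≤ -26 := by
    have h1 : (2 : ℝ) ^ e < (2 : ℝ) ^ (-25 : ℤ) := lt_of_le_of_lt he1 (lt_of_le_of_lt hb (by norm_num))
    have := (zpow_lt_zpow_iff_right₀ (by norm_num : (1 : ℝ) < 2)).1 h1
    omega
  have hU : (0 : ℝ) < (2 : ℝ) ^ (e - 53) := by positivity
  have hε1 : ε ≤ 1 := hb.trans (by norm_num)
  have key : ε ^ 3 / 6 + ε ^ 5 / 10 < (2 : ℝ) ^ (e - 53) := by
    rcases (show e = -26 ∨ e ≤ -27 by omega) with h26 | h27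
    · subst h26
      have h3 : ε ^ 3 ≤ (6495314627411701 / 2 ^ 78 : ℝ) ^ 3 := pow_le_pow_left₀ h0.le hb 3
      have h5 : ε ^ 5 ≤ (6495314627411701 / 2 ^ 78 : ℝ) ^ 5 := pow_le_pow_left₀ h0.le hb 5
      have hnum : ((6495314627411701 / 2 ^ 78 : ℝ)) ^ 3 / 6 + ((6495314627411701 / 2 ^ 78 : ℝ)) ^ 5 / 10
          < (2 : ℝ) ^ ((-26 : ℤ) - 53) := by
        norm_num
      linarith
    · have h3 : ε ^ 3 < ((2 : ℝ) ^ (e + 1)) ^ 3 := pow_lt_pow_left₀ he2 h0.le (by norm_num)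
      have hεh : ε ≤ 1 / 2 := hb.trans (by norm_num)
      have h5 : ε ^ 5 ≤ ε ^ 3 / 4 := by
        have e5 : ε ^ 5 = ε ^ 3 * ε ^ 2 := by ring
        have h2 : ε ^ 2 ≤ 1 / 4 := by nlinarith
        rw [e5]; nlinarith [pow_pos h0 3]
      have hsplit : ((2 : ℝ) ^ (e + 1)) ^ 3 = (2 : ℝ) ^ (e - 53) * (2 : ℝ) ^ (2 * e + 56) := by
        rw [← zpow_natCast, ← zpow_mul, ← zpow_add₀ (by norm_num)]; congr 1; push_cast; ring
      have hsmall : (2 : ℝ) ^ (2 * e + 56) ≤ (2 : ℝ) ^ (2 : ℤ) :=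
        zpow_le_zpow_right₀ (by norm_num) (by omega)
      have h22 : (2 : ℝ) ^ (2 : ℤ) = 4 := by norm_num
      rw [h22] at hsmall
      have := mul_le_mul_of_nonneg_left hsmall hU.le
      rw [← hsplit] at this
      linarith
  rcases he1.lt_or_eq with hne | heq
  · apply rn_eq_of_abs_sub_lt_53 hRN hε hne
    rw [abs_of_nonpos (by linarith)]
    linarith
  · rw [← heq] at hf1 hf2 key ⊢
    have hV : (0 : ℝ) < (2 : ℝ) ^ (e - 54) := by positivity
    exact rn_eq_two_zpow_53 hRN (by linarith) (by linarith)

/-- **Row `arcsin` of Table I, CONFIRMED as a theorem:** for every precision-53 float `ε` with `|ε| < α`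
and every round-to-nearest, `RN(arcsin ε) = ε`. Sharp: the cell's check shows the claim fails AT `α`
(by `4·10^−17` of the half-gap) — exactly why the table prints `<` here and `≤` for `sin`.
[cite: DedinechinEtAl2013, Table I] -/
theorem rn_arcsin_tiny (hRN : IsRoundNearest 53 RN) {ε : ℝ} (hε : IsFloat 53 ε) (hα : |ε| < alpha) :
    RN (Real.arcsin ε) = ε := by
  have hpos : ∀ (RN : ℝ → ℝ), IsRoundNearest 53 RN → ∀ ε, IsFloat 53 ε → 0 < ε → ε < alpha →
      RN (Real.arcsin ε) = ε := by
    intro RN hRN ε hε h0 hb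
    have hb1 : ε ≤ 1 / 2 := hb.le.trans (by rw [alpha_eq]; norm_num)
    obtain ⟨t1, t2⟩ := arcsin_bounds h0.le hb1
    exact rn_eq_of_outer_sixth_lt hRN hε h0 hb t1 t2
  rcases lt_trichotomy ε 0 with hneg | hzero | hp
  · exact rn_odd_of_pos Real.arcsin_neg hpos hRN hε hneg (by rwa [abs_of_neg hneg] at hα)
  · subst hzero
    rw [Real.arcsin_zero]
    have h0 := hRN.nearest 0 0 ⟨0, 0, by norm_num, by simp⟩
    simp only [sub_zero, sub_self, abs_zero] at h0
    exact abs_nonpos_iff.1 h0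
  · exact hpos RN hRN ε hε hp (by rwa [abs_of_pos hp] at hα)

end ArcsinRow

/-! ### `expm1`, second line: `RN(√2)·2^−53 ≤ ε < RN(√3)·2^−52 ⇒ RN(e^ε − 1) = ε⁺` -/

section Expm1Succ

variable {RN : ℝ → ℝ}

/-- `RN(√3) × 2^−52` of Table I as the exact dyadic `7800463371553962 · 2^−104`
(`RN(√3) = 7800463371553962·2^−52`, see `s3_isRN_sqrt3`). [cite: DedinechinEtAl2013, Table I] -/
noncomputable def s3 : ℝ := 7800463371553962 / 2 ^ 104

/-- Unfolding `s3`. [cite: DedinechinEtAl2013, Table I] -/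
theorem s3_eq : s3 = 7800463371553962 / 2 ^ 104 := rfl

/-- `7800463371553962·2^−52` is the binary64 number nearest to `√3` (`((2m−1)/2^53)² < 3 < ((2m+1)/2^53)²`,
`m` has 53 bits), so `s3 = RN(√3)·2^−52` as printed. [cite: DedinechinEtAl2013, Table I] -/
theorem s3_isRN_sqrt3 :
    (2 * 7800463371553962 - 1 : ℤ) ^ 2 < 3 * 2 ^ 106 ∧ 3 * 2 ^ 106 < (2 * 7800463371553962 + 1 : ℤ) ^ 2
      ∧ 2 ^ 52 ≤ (7800463371553962 : ℤ) ∧ (7800463371553962 : ℤ) < 2 ^ 53 := by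
  refine ⟨by norm_num, by norm_num, by norm_num, by norm_num⟩

/-- The SUCCESSOR of a float `ε ∈ [2^e, 2^(e+1))` in precision 53 is `ε + 2^(e−52)`: it is a float, and no
float lies strictly between (`IsFloat.add_ulp_le_of_lt`). This is the `ε⁺` of Table I ("the smallest
floating-point number strictly larger than ε"). [cite: DedinechinEtAl2013, Table I] -/
theorem succ_spec {ε : ℝ} {e : ℤ} (hε : IsFloat 53 ε) (he1 : (2 : ℝ) ^ e ≤ ε) (he2 : ε < (2 : ℝ) ^ (e + 1)) :
    IsFloat 53 (ε + (2 : ℝ) ^ (e - 52)) ∧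
      ∀ f : ℝ, IsFloat 53 f → ε < f → ε + (2 : ℝ) ^ (e - 52) ≤ f := by
  have hU : (0 : ℝ) < (2 : ℝ) ^ (e - (53 : ℕ) + 1) := by positivity
  have h2e : (0 : ℝ) < (2 : ℝ) ^ e := by positivity
  have hue : (2 : ℝ) ^ (e - (53 : ℕ) + 1) = (2 : ℝ) ^ (e - 52) := by congr 1; push_cast; ring
  obtain ⟨K, hK⟩ := hε.exists_int_mul_of_le (e := e) (by rw [abs_of_pos (by linarith)]; exact he1)
  have hpow : (2 : ℝ) ^ (e + 1) = ((2 ^ 53 : ℤ) : ℝ) * (2 : ℝ) ^ (e - (53 : ℕ) + 1) := by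
    have h53 : ((2 ^ 53 : ℤ) : ℝ) = (2 : ℝ) ^ (53 : ℤ) := by push_cast; norm_num
    rw [h53, ← zpow_add₀ (by norm_num : (2 : ℝ) ≠ 0)]; congr 1; push_cast; ring
  have hKp : K < 2 ^ 53 := by
    have : (K : ℝ) * (2 : ℝ) ^ (e - (53 : ℕ) + 1) < ((2 ^ 53 : ℤ) : ℝ) * (2 : ℝ) ^ (e - (53 : ℕ) + 1) := by
      rw [← hpow, ← hK]; exact he2
    exact_mod_cast lt_of_mul_lt_mul_right this hU.le
  have hK0 : 0 < K := by
    have : (0 : ℝ) < K := by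
      by_contra hle; push Not at hle
      have := mul_nonpos_of_nonpos_of_nonneg hle hU.le; linarith
    exact_mod_cast this
  constructor
  · have hf := IsFloat.of_abs_le (p := 53) (by norm_num) (K := K + 1) (E := e - (53 : ℕ) + 1)
      (by rw [abs_of_pos (by linarith)]; exact Int.add_one_le_iff.mpr hKp)
    have e1 : ε + (2 : ℝ) ^ (e - 52) = ((K + 1 : ℤ) : ℝ) * (2 : ℝ) ^ (e - (53 : ℕ) + 1) := by
      rw [hK, ← hue]; push_cast; ring
    rw [e1]; exact hf
  · intro f hf hlt
    have := hε.add_ulp_le_of_lt hf he1 hlt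
    rwa [hue] at this

/-- A positive float strictly below `s3` is at most its predecessor `7800463371553961·2^−104`.
[cite: DedinechinEtAl2013, §2.1.1] -/
theorem le_pred_s3_of_lt {ε : ℝ} (hε : IsFloat 53 ε) (h0 : 0 < ε) (h : ε < s3) :
    ε ≤ 7800463371553961 / 2 ^ 104 := by
  rcases lt_or_ge ε ((2 : ℝ) ^ (-52 : ℤ)) with hlt | hge
  · exact hlt.le.trans (by norm_num)
  · obtain ⟨K, hK⟩ := hε.exists_int_mul_of_le (e := -52) (by rw [abs_of_pos h0]; exact hge)
    have h2 : (0 : ℝ) < (2 : ℝ) ^ ((-52 : ℤ) - (53 : ℕ) + 1) := by positivity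
    have hK' : (K : ℝ) < 7800463371553962 := by
      rw [hK, s3_eq] at h
      have : (K : ℝ) * (2 : ℝ) ^ ((-52 : ℤ) - (53 : ℕ) + 1)
          < 7800463371553962 * (2 : ℝ) ^ ((-52 : ℤ) - (53 : ℕ) + 1) := by
        refine lt_of_lt_of_le h (le_of_eq ?_); norm_num
      exact lt_of_mul_lt_mul_right this h2.le
    have hKi : K ≤ 7800463371553961 := by
      have : K < 7800463371553962 := by exact_mod_cast hK'
      omega
    have hKr : (K : ℝ) ≤ 7800463371553961 := by exact_mod_cast hKi
    rw [hK]
    calc (K : ℝ) * (2 : ℝ) ^ ((-52 : ℤ) - (53 : ℕ) + 1)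
        ≤ 7800463371553961 * (2 : ℝ) ^ ((-52 : ℤ) - (53 : ℕ) + 1) := mul_le_mul_of_nonneg_right hKr h2.le
      _ = 7800463371553961 / 2 ^ 104 := by norm_num

/-- Rounding to the SUCCESSOR: if `ε ∈ [2^e, 2^(e+1))` is a float and `y − ε` lies strictly between half an
ulp and three halves of an ulp (`ulp = 2^(e−52)`), then `RN y = ε + ulp = ε⁺` for every round-to-nearest
(whether or not `ε⁺` is the power of two `2^(e+1)`). [cite: DedinechinEtAl2013, §2.1] -/
theorem rn_eq_succ_of_dev (hRN : IsRoundNearest 53 RN) {ε y : ℝ} {e : ℤ} (hε : IsFloat 53 ε)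
    (he1 : (2 : ℝ) ^ e ≤ ε) (he2 : ε < (2 : ℝ) ^ (e + 1))
    (hlo : (2 : ℝ) ^ (e - 53) < y - ε) (hhi : y - ε < 3 * (2 : ℝ) ^ (e - 53)) :
    RN y = ε + (2 : ℝ) ^ (e - 52) := by
  obtain ⟨ht, hgap⟩ := succ_spec hε he1 he2
  have hu : (2 : ℝ) ^ (e - 52) = 2 * (2 : ℝ) ^ (e - 53) := by
    rw [show e - 52 = (e - 53) + 1 by ring, zpow_add_one₀ two_ne_zero]; ring
  have hU : (0 : ℝ) < (2 : ℝ) ^ (e - 53) := by positivity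
  -- ε⁺ ≤ 2^(e+1), since 2^(e+1) is a float above ε
  have hle : ε + (2 : ℝ) ^ (e - 52) ≤ (2 : ℝ) ^ (e + 1) := hgap _ (IsFloat.two_zpow (by norm_num) _) he2
  rcases hle.lt_or_eq with hlt | heq
  · -- ε⁺ inside the binade: not a power of two, half-gap 2^(e-53) on both sides
    have hgt : (2 : ℝ) ^ e < ε + (2 : ℝ) ^ (e - 52) := by
      have : (0 : ℝ) < (2 : ℝ) ^ (e - 52) := by positivity
      linarith
    apply rn_eq_of_abs_sub_lt_53 hRN ht hgt
    rw [abs_sub_lt_iff]; constructor <;> linarith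
  · -- ε⁺ = 2^(e+1)
    rw [heq]
    have h54 : (2 : ℝ) ^ (e + 1 - 54) = (2 : ℝ) ^ (e - 53) := by congr 1; ring
    have h53 : (2 : ℝ) ^ (e + 1 - 53) = (2 : ℝ) ^ (e - 52) := by congr 1; ring
    apply rn_eq_two_zpow_53 hRN
    · rw [h54]; linarith
    · rw [h53]; linarith

/-- **Row `expm1`, second line, of Table I, CONFIRMED as a theorem (lower binade):** for every
precision-53 float `ε` with `RN(√2)·2^−53 ≤ ε < 2^−52` and every round-to-nearest,
`RN(e^ε − 1) = ε + 2^−105 = ε⁺` (`succ_spec` with `e = −53`). The deviation `e^ε − 1 − ε ≥ ε²/2 ≥ s2²/2`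
exceeds the half-ulp `2^−106` exactly because `RN(√2)` rounds UP (`s2_isRN_sqrt2`; sharp: at `pred s2`
the first line applies), and stays below `3·2^−106`. [cite: DedinechinEtAl2013, Table I] -/
theorem rn_expm1_tiny_succ_low (hRN : IsRoundNearest 53 RN) {ε : ℝ} (hε : IsFloat 53 ε)
    (h1 : s2 ≤ ε) (h2 : ε < (2 : ℝ) ^ (-52 : ℤ)) :
    RN (Real.exp ε - 1) = ε + (2 : ℝ) ^ (-105 : ℤ) := by
  have hs2pos : (2 : ℝ) ^ (-53 : ℤ) ≤ s2 := by rw [s2_eq]; norm_num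
  have h0 : 0 < ε := lt_of_lt_of_le (by rw [s2_eq]; norm_num) h1
  have he1 : (2 : ℝ) ^ (-53 : ℤ) ≤ ε := hs2pos.trans h1
  have he2 : ε < (2 : ℝ) ^ ((-53 : ℤ) + 1) := by rwa [show (-53 : ℤ) + 1 = -52 by norm_num]
  have hxa : |ε| ≤ 1 := by rw [abs_of_pos h0]; exact h2.le.trans (by norm_num)
  have hb := Real.exp_bound hxa (show 0 < 3 by norm_num)
  rw [abs_of_pos h0] at hb
  obtain ⟨k1, k2⟩ := abs_sub_le_iff.1 hb
  simp only [Finset.sum_range_succ, Finset.sum_range_zero, Nat.factorial] at k1 k2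
  norm_num at k1 k2
  have hq := Real.quadratic_le_exp_of_nonneg h0.le
  have htop : ε ≤ (2 : ℝ) ^ ((-53 : ℤ) + 1) - (2 : ℝ) ^ ((-53 : ℤ) + 1 - (53 : ℕ)) :=
    hε.le_sub_of_lt (by norm_num) he2
  have htop' : ε ≤ 1 / 2 ^ 52 - 1 / 2 ^ 105 := htop.trans (le_of_eq (by norm_num))
  have h106 : (2 : ℝ) ^ ((-53 : ℤ) - 53) = 1 / 2 ^ 106 := by norm_num
  have := rn_eq_succ_of_dev hRN hε he1 he2 (y := Real.exp ε - 1) ?_ ?_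
  · rwa [show (-53 : ℤ) - 52 = -105 by norm_num] at this
  · -- lower: s2²/2 > 2^-106 (linarith only ever sees plain rationals, never `zpow` atoms)
    rw [h106]
    have hsq : s2 ^ 2 ≤ ε ^ 2 := pow_le_pow_left₀ (by rw [s2_eq]; norm_num) h1 2
    rw [s2_eq] at hsq
    have hnum : (1 : ℝ) / 2 ^ 106 < (6369051672525773 / 2 ^ 105 : ℝ) ^ 2 / 2 := by norm_num
    linarith
  · -- upper: ε²/2 + (2/9)ε³ < 3·2^-106
    rw [h106]
    have hsq : ε ^ 2 ≤ (1 / 2 ^ 52 - 1 / 2 ^ 105 : ℝ) ^ 2 := pow_le_pow_left₀ h0.le htop' 2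
    have hcu : ε ^ 3 ≤ (1 / 2 ^ 52 - 1 / 2 ^ 105 : ℝ) ^ 3 := pow_le_pow_left₀ h0.le htop' 3
    have hnum : ((1 / 2 ^ 52 - 1 / 2 ^ 105 : ℝ)) ^ 2 / 2 + 2 / 9 * ((1 / 2 ^ 52 - 1 / 2 ^ 105 : ℝ)) ^ 3
        < 3 * ((1 : ℝ) / 2 ^ 106) := by norm_num
    linarith

/-- **Row `expm1`, second line, of Table I, CONFIRMED as a theorem (upper binade):** for every
precision-53 float `ε` with `2^−52 ≤ ε < RN(√3)·2^−52` and every round-to-nearest,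
`RN(e^ε − 1) = ε + 2^−104 = ε⁺`. At `ε = 2^−52` the quadratic deviation `ε²/2` equals the half-ulp
`2^−105` exactly and the cubic term decides (`Real.sum_le_exp_of_nonneg`, four terms); the upper end is
sharp because `RN(√3)` rounds DOWN (`s3_isRN_sqrt3`): at `pred s3` the deviation is still below `3·2^−105`,
at `s3` it is not (cell check). [cite: DedinechinEtAl2013, Table I] -/
theorem rn_expm1_tiny_succ_high (hRN : IsRoundNearest 53 RN) {ε : ℝ} (hε : IsFloat 53 ε)
    (h1 : (2 : ℝ) ^ (-52 : ℤ) ≤ ε) (h2 : ε < s3) :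
    RN (Real.exp ε - 1) = ε + (2 : ℝ) ^ (-104 : ℤ) := by
  have h0 : 0 < ε := lt_of_lt_of_le (by norm_num) h1
  have hb3 := le_pred_s3_of_lt hε h0 h2
  have he2 : ε < (2 : ℝ) ^ ((-52 : ℤ) + 1) := lt_of_le_of_lt hb3 (by norm_num)
  have hxa : |ε| ≤ 1 := by rw [abs_of_pos h0]; exact hb3.trans (by norm_num)
  have hb := Real.exp_bound hxa (show 0 < 3 by norm_num)
  rw [abs_of_pos h0] at hb
  obtain ⟨k1, k2⟩ := abs_sub_le_iff.1 hb
  simp only [Finset.sum_range_succ, Finset.sum_range_zero, Nat.factorial] at k1 k2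
  norm_num at k1 k2
  have hq := Real.sum_le_exp_of_nonneg h0.le 4
  simp only [Finset.sum_range_succ, Finset.sum_range_zero, Nat.factorial] at hq
  norm_num at hq
  have h105 : (2 : ℝ) ^ ((-52 : ℤ) - 53) = 1 / 2 ^ 105 := by norm_num
  have h1' : (1 : ℝ) / 2 ^ 52 ≤ ε := (show (1 : ℝ) / 2 ^ 52 = (2 : ℝ) ^ (-52 : ℤ) by norm_num).trans_le h1
  have := rn_eq_succ_of_dev hRN hε h1 he2 (y := Real.exp ε - 1) ?_ ?_
  · rwa [show (-52 : ℤ) - 52 = -104 by norm_num] at this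
  · -- lower: ε²/2 + ε³/6 > 2^-105 (at ε = 2^-52 the cubic term decides)
    rw [h105]
    have hsq : ((1 : ℝ) / 2 ^ 52) ^ 2 ≤ ε ^ 2 := pow_le_pow_left₀ (by positivity) h1' 2
    have hcu : 0 < ε ^ 3 := by positivity
    have hnum : (1 : ℝ) / 2 ^ 105 ≤ ((1 : ℝ) / 2 ^ 52) ^ 2 / 2 := by norm_num
    linarith
  · -- upper: ε ≤ pred s3
    rw [h105]
    have hsq : ε ^ 2 ≤ (7800463371553961 / 2 ^ 104 : ℝ) ^ 2 := pow_le_pow_left₀ h0.le hb3 2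
    have hcu : ε ^ 3 ≤ (7800463371553961 / 2 ^ 104 : ℝ) ^ 3 := pow_le_pow_left₀ h0.le hb3 3
    have hnum : ((7800463371553961 / 2 ^ 104 : ℝ)) ^ 2 / 2 + 2 / 9 * ((7800463371553961 / 2 ^ 104 : ℝ)) ^ 3
        < 3 * ((1 : ℝ) / 2 ^ 105) := by norm_num
    linarith

end Expm1Succ

/-! ### The corrected η rows are SHARP: `β₆` for `tan`/`atanh`, the next float `β₇` for `tanh`/`arctan` -/

section SharpCorrected

variable {RN : ℝ → ℝ}

/-- `β₇ = 8183583624766079 · 2^−79`, the float following `β₆` in the binade `[2^−27, 2^−26)`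
(`6^{1/3}·2^52 = 8183583624766078.95…`, so `β₆ < 6^{1/3}·2^−27 < β₇`: the cubic term `x³/3` alone crosses
the half-gap `2^−80` between `β₆` and `β₇`, and at `β₇` the fifth-order terms decide — `−2x⁵/15` (`tanh`),
`−x⁵/5` (`arctan`) rescue the row, `+2x⁵/15` (`tan`), `+x⁵/5` (`atanh`) do not).
[cite: DedinechinEtAl2013, Table I] -/
noncomputable def beta7 : ℝ := 8183583624766079 / 2 ^ 79

/-- Unfolding `beta7`. [cite: DedinechinEtAl2013, Table I] -/
theorem beta7_eq : beta7 = 8183583624766079 / 2 ^ 79 := rfl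

/-- `β₇` and its successor `β₇ + 2^−79 = 8183583624766080·2^−79` are precision-53 floats, and
`(6^{1/3}·2^−27)³ = 6·2^−81` separates `β₆` from `β₇`: `β₆³ < 6·2^−81 < β₇³` (so `x³/3 < 2^−80` iff `x ≤ β₆`).
[cite: DedinechinEtAl2013, Table I] -/
theorem beta7_isFloat : IsFloat 53 beta7 ∧ IsFloat 53 (beta7 + (2 : ℝ) ^ (-79 : ℤ)) ∧ beta6 < beta7 ∧
    beta6 ^ 3 < 6 * (2 : ℝ) ^ (-81 : ℤ) ∧ 6 * (2 : ℝ) ^ (-81 : ℤ) < beta7 ^ 3 := by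
  refine ⟨⟨8183583624766079, -79, by norm_num, ?_⟩, ⟨8183583624766080, -79, by norm_num, ?_⟩, ?_, ?_, ?_⟩
  · rw [beta7_eq]; push_cast; norm_num
  · rw [beta7_eq]; push_cast; norm_num
  · rw [beta6_eq, beta7_eq]; norm_num
  · rw [beta6_eq]; norm_num
  · rw [beta7_eq]; norm_num

/-- Consecutive floats: a precision-53 float strictly above `β₆` is at least `β₇`.
[cite: DedinechinEtAl2013, §2.1.1] -/
theorem beta7_le_of_beta6_lt {ε : ℝ} (hε : IsFloat 53 ε) (h : beta6 < ε) : beta7 ≤ ε := by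
  have h27 : (2 : ℝ) ^ (-27 : ℤ) ≤ ε := le_trans (by rw [beta6_eq]; norm_num) h.le
  have h0 : 0 < ε := lt_of_lt_of_le (by positivity) h27
  obtain ⟨K, hK⟩ := hε.exists_int_mul_of_le (e := -27) (by rw [abs_of_pos h0]; exact h27)
  have h2 : (0 : ℝ) < (2 : ℝ) ^ ((-27 : ℤ) - (53 : ℕ) + 1) := by positivity
  have hK' : (8183583624766078 : ℝ) < K := by
    rw [hK, beta6_eq] at h
    have : 8183583624766078 * (2 : ℝ) ^ ((-27 : ℤ) - (53 : ℕ) + 1)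
        < (K : ℝ) * (2 : ℝ) ^ ((-27 : ℤ) - (53 : ℕ) + 1) := by
      refine lt_of_le_of_lt (le_of_eq ?_) h; norm_num
    exact lt_of_mul_lt_mul_right this h2.le
  have hKi : 8183583624766079 ≤ K := by
    have : (8183583624766078 : ℤ) < K := by exact_mod_cast hK'
    omega
  have hKr : (8183583624766079 : ℝ) ≤ K := by exact_mod_cast hKi
  rw [hK, beta7_eq]
  calc (8183583624766079 : ℝ) / 2 ^ 79 = 8183583624766079 * (2 : ℝ) ^ ((-27 : ℤ) - (53 : ℕ) + 1) := by
        norm_num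
    _ ≤ (K : ℝ) * (2 : ℝ) ^ ((-27 : ℤ) - (53 : ℕ) + 1) := mul_le_mul_of_nonneg_right hKr h2.le

/-- Seven-term enclosure of `arctan` on `[0, ∞)`: `x − x³/3 + x⁵/5 − x⁷/7 ≤ arctan x ≤ x − x³/3 + x⁵/5`
(the defects have derivatives `x⁸/(1+x²)` and `x⁶/(1+x²)`). [cite: DedinechinEtAl2013, Table I] -/
theorem arctan_quintic_bounds {x : ℝ} (hx : 0 ≤ x) :
    x - x ^ 3 / 3 + x ^ 5 / 5 - x ^ 7 / 7 ≤ Real.arctan x ∧ Real.arctan x ≤ x - x ^ 3 / 3 + x ^ 5 / 5 := by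
  constructor
  · let g (t : ℝ) : ℝ := Real.arctan t - (t - t ^ 3 / 3 + t ^ 5 / 5 - t ^ 7 / 7)
    have hd : ∀ t, HasDerivAt g (t ^ 8 / (1 + t ^ 2)) t := fun t => by
      have h1 : (0 : ℝ) < 1 + t ^ 2 := by positivity
      have h : HasDerivAt (fun y => Real.arctan y - (y - y ^ 3 / 3 + y ^ 5 / 5 - y ^ 7 / 7))
          (1 / (1 + t ^ 2) - (1 - ↑(3 : ℕ) * t ^ (3 - 1) / 3 + ↑(5 : ℕ) * t ^ (5 - 1) / 5
            - ↑(7 : ℕ) * t ^ (7 - 1) / 7)) t :=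
        (Real.hasDerivAt_arctan t).sub ((((hasDerivAt_id' t).sub ((hasDerivAt_pow 3 t).div_const 3)).add
          ((hasDerivAt_pow 5 t).div_const 5)).sub ((hasDerivAt_pow 7 t).div_const 7))
      refine h.congr_deriv ?_
      rw [eq_div_iff h1.ne']
      field_simp
      ring
    have hmono : MonotoneOn g (Set.Ici 0) := by
      apply monotoneOn_of_deriv_nonneg (convex_Ici 0)
        (fun t _ => (hd t).continuousAt.continuousWithinAt)
        (fun t _ => (hd t).differentiableAt.differentiableWithinAt)
      intro t _
      rw [(hd t).deriv]
      positivity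
    have h0 : g 0 ≤ g x := hmono (by simp) (by simpa using hx) hx
    simp only [g, Real.arctan_zero] at h0
    linarith
  · let g (t : ℝ) : ℝ := (t - t ^ 3 / 3 + t ^ 5 / 5) - Real.arctan t
    have hd : ∀ t, HasDerivAt g (t ^ 6 / (1 + t ^ 2)) t := fun t => by
      have h1 : (0 : ℝ) < 1 + t ^ 2 := by positivity
      have h : HasDerivAt (fun y => (y - y ^ 3 / 3 + y ^ 5 / 5) - Real.arctan y)
          ((1 - ↑(3 : ℕ) * t ^ (3 - 1) / 3 + ↑(5 : ℕ) * t ^ (5 - 1) / 5) - 1 / (1 + t ^ 2)) t :=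
        (((hasDerivAt_id' t).sub ((hasDerivAt_pow 3 t).div_const 3)).add
          ((hasDerivAt_pow 5 t).div_const 5)).sub (Real.hasDerivAt_arctan t)
      refine h.congr_deriv ?_
      rw [eq_div_iff h1.ne']
      field_simp
      ring
    have hmono : MonotoneOn g (Set.Ici 0) := by
      apply monotoneOn_of_deriv_nonneg (convex_Ici 0)
        (fun t _ => (hd t).continuousAt.continuousWithinAt)
        (fun t _ => (hd t).differentiableAt.differentiableWithinAt)
      intro t _
      rw [(hd t).deriv]
      positivity
    have h0 : g 0 ≤ g x := hmono (by simp) (by simpa using hx) hx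
    simp only [g, Real.arctan_zero] at h0
    linarith

/-- Seven-term enclosure of `tanh` on `[0, 1]`: `x − x³/3 + (2/15)x⁵ − x⁷/5 ≤ tanh x ≤ x − x³/3 + (2/15)x⁵`
(bootstrapped from `tanh_bounds` through the derivative `tanh' = 1 − tanh²`; the true `x⁷` coefficient is
`−17/315`, the slack is immaterial here). [cite: DedinechinEtAl2013, Table I] -/
theorem tanh_quintic_bounds {x : ℝ} (hx0 : 0 ≤ x) (hx1 : x ≤ 1) :
    x - x ^ 3 / 3 + 2 / 15 * x ^ 5 - x ^ 7 / 5 ≤ Real.tanh x ∧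
      Real.tanh x ≤ x - x ^ 3 / 3 + 2 / 15 * x ^ 5 := by
  have hdt : ∀ t, HasDerivAt Real.tanh (1 - Real.tanh t ^ 2) t := by
    intro t
    have hc : Real.cosh t ≠ 0 := (Real.cosh_pos t).ne'
    have h := (Real.hasDerivAt_sinh t).div (Real.hasDerivAt_cosh t) hc
    have hfun : Real.sinh / Real.cosh = Real.tanh := by
      funext y; simp [Real.tanh_eq_sinh_div_cosh]
    rw [hfun] at h
    refine h.congr_deriv ?_
    rw [Real.tanh_eq_sinh_div_cosh, div_pow]
    field_simp
  -- Step A: the upper bound, from `tanh t ≥ t − t³/3 ≥ 0` on `(0, 1)`.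
  have hA : ∀ y, 0 ≤ y → y ≤ 1 → Real.tanh y ≤ y - y ^ 3 / 3 + 2 / 15 * y ^ 5 := by
    intro y hy0 hy1
    let h (t : ℝ) : ℝ := (t - t ^ 3 / 3 + 2 / 15 * t ^ 5) - Real.tanh t
    have hd : ∀ t, HasDerivAt h
        ((1 - ↑(3 : ℕ) * t ^ (3 - 1) / 3 + 2 / 15 * (↑(5 : ℕ) * t ^ (5 - 1))) - (1 - Real.tanh t ^ 2)) t :=
      fun t => (((hasDerivAt_id' t).sub ((hasDerivAt_pow 3 t).div_const 3)).add
        ((hasDerivAt_pow 5 t).const_mul (2 / 15))).sub (hdt t)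
    have hmono : MonotoneOn h (Set.Icc 0 1) := by
      apply monotoneOn_of_deriv_nonneg (convex_Icc 0 1)
        (fun t _ => (hd t).continuousAt.continuousWithinAt)
        (fun t _ => (hd t).differentiableAt.differentiableWithinAt)
      intro t ht
      rw [interior_Icc] at ht
      obtain ⟨ht0, ht1⟩ := ht
      rw [(hd t).deriv]
      obtain ⟨l1, _⟩ := tanh_bounds ht0 ht1.le
      have ht2 : t ^ 2 ≤ 1 := by nlinarith
      have hT : 0 ≤ t - t ^ 3 / 3 := by nlinarith
      have hsq : (t - t ^ 3 / 3) ^ 2 ≤ Real.tanh t ^ 2 := pow_le_pow_left₀ hT l1 2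
      have hex : (t - t ^ 3 / 3) ^ 2 = t ^ 2 - 2 / 3 * t ^ 4 + t ^ 6 / 9 := by ring
      have h6 : 0 ≤ t ^ 6 := by positivity
      rw [hex] at hsq
      push_cast
      linarith
    have hh0 : h 0 = 0 := by simp [h]
    have := hmono (by simp) ⟨hy0, hy1⟩ hy0
    rw [hh0] at this
    simp only [h] at this
    linarith
  refine ⟨?_, hA x hx0 hx1⟩
  -- Step B: the lower bound, from `0 ≤ tanh t ≤ t − t³/3 + (2/15)t⁵` (Step A) on `(0, 1)`.
  let k (t : ℝ) : ℝ := Real.tanh t - (t - t ^ 3 / 3 + 2 / 15 * t ^ 5 - t ^ 7 / 5)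
  have hd : ∀ t, HasDerivAt k ((1 - Real.tanh t ^ 2) -
      (1 - ↑(3 : ℕ) * t ^ (3 - 1) / 3 + 2 / 15 * (↑(5 : ℕ) * t ^ (5 - 1)) - ↑(7 : ℕ) * t ^ (7 - 1) / 5)) t :=
    fun t => (hdt t).sub ((((hasDerivAt_id' t).sub ((hasDerivAt_pow 3 t).div_const 3)).add
      ((hasDerivAt_pow 5 t).const_mul (2 / 15))).sub ((hasDerivAt_pow 7 t).div_const 5))
  have hmono : MonotoneOn k (Set.Icc 0 1) := by
    apply monotoneOn_of_deriv_nonneg (convex_Icc 0 1)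
      (fun t _ => (hd t).continuousAt.continuousWithinAt)
      (fun t _ => (hd t).differentiableAt.differentiableWithinAt)
    intro t ht
    rw [interior_Icc] at ht
    obtain ⟨ht0, ht1⟩ := ht
    rw [(hd t).deriv]
    obtain ⟨l1, _⟩ := tanh_bounds ht0 ht1.le
    have ht2 : t ^ 2 ≤ 1 := by nlinarith
    have hT : 0 ≤ t - t ^ 3 / 3 := by nlinarith
    have htanh0 : 0 ≤ Real.tanh t := hT.trans l1
    have hsq : Real.tanh t ^ 2 ≤ (t - t ^ 3 / 3 + 2 / 15 * t ^ 5) ^ 2 :=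
      pow_le_pow_left₀ htanh0 (hA t ht0.le ht1.le) 2
    have hex : (t - t ^ 3 / 3 + 2 / 15 * t ^ 5) ^ 2
        = t ^ 2 - 2 / 3 * t ^ 4 + 17 / 45 * t ^ 6 - 4 / 45 * t ^ 8 + 4 / 225 * t ^ 10 := by ring
    have h108 : t ^ 10 ≤ t ^ 8 := pow_le_pow_of_le_one ht0.le ht1.le (by norm_num)
    have h6 : 0 ≤ t ^ 6 := by positivity
    have h8 : 0 ≤ t ^ 8 := by positivity
    rw [hex] at hsq
    push_cast
    linarith
  have hk0 : k 0 = 0 := by simp [k]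
  have := hmono (by simp) ⟨hx0, hx1⟩ hx0
  rw [hk0] at this
  simp only [k] at this
  linarith

/-- `x + x³/3 ≤ tan x` for `0 ≤ x ≤ 1` (the defect has derivative `tan²x − x² ≥ 0`, Mathlib `Real.le_tan`).
[cite: DedinechinEtAl2013, Table I] -/
theorem add_cube_div_three_le_tan {x : ℝ} (hx0 : 0 ≤ x) (hx1 : x ≤ 1) : x + x ^ 3 / 3 ≤ Real.tan x := by
  have hpi := Real.pi_gt_three
  let g (t : ℝ) : ℝ := Real.tan t - (t + t ^ 3 / 3)
  have hd : ∀ t, 0 ≤ t → t ≤ 1 → HasDerivAt g (Real.tan t ^ 2 - t ^ 2) t := by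
    intro t ht0 ht1
    have hc : Real.cos t ≠ 0 := (cos_pos_of_le_one ht0 ht1).ne'
    have h : HasDerivAt (fun y => Real.tan y - (y + y ^ 3 / 3))
        (1 / Real.cos t ^ 2 - (1 + ↑(3 : ℕ) * t ^ (3 - 1) / 3)) t :=
      (Real.hasDerivAt_tan hc).sub ((hasDerivAt_id' t).add ((hasDerivAt_pow 3 t).div_const 3))
    refine h.congr_deriv ?_
    rw [one_div, ← Real.inv_one_add_tan_sq hc, inv_inv]
    push_cast
    ring
  have hmono : MonotoneOn g (Set.Icc 0 1) := by
    apply monotoneOn_of_deriv_nonneg (convex_Icc 0 1)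
      (fun t ht => (hd t ht.1 ht.2).continuousAt.continuousWithinAt)
      (fun t ht => by
        rw [interior_Icc] at ht
        exact (hd t ht.1.le ht.2.le).differentiableAt.differentiableWithinAt)
    intro t ht
    rw [interior_Icc] at ht
    obtain ⟨ht0, ht1⟩ := ht
    rw [(hd t ht0.le ht1.le).deriv]
    have htan : t ≤ Real.tan t := Real.le_tan ht0.le (by linarith)
    nlinarith [htan, ht0]
  have hg0 : g 0 = 0 := by simp [g]
  have := hmono (by simp) ⟨hx0, hx1⟩ hx0
  rw [hg0] at this
  simp only [g] at this
  linarith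

/-- `x + x³/3 + x⁵/5 − 2x⁶ ≤ atanh x` for `0 < x ≤ 1/8` (logarithm series to five terms, as in
`artanh_bounds`, keeping the `x⁵/5` term). [cite: DedinechinEtAl2013, Table I] -/
theorem artanh_lower_quintic {x : ℝ} (hx0 : 0 < x) (hx1 : x ≤ 1 / 8) :
    x + x ^ 3 / 3 + x ^ 5 / 5 - 2 * x ^ 6 ≤ Real.artanh x := by
  have hart : Real.artanh x = 1 / 2 * (Real.log (1 + x) - Real.log (1 - x)) := by
    rw [Real.artanh_eq_half_log ⟨by linarith, by linarith⟩, Real.log_div (by linarith) (by linarith)]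
  have hl1 := Real.abs_log_sub_add_sum_range_le (x := x) (by rw [abs_of_pos hx0]; linarith) 5
  have hl2 := Real.abs_log_sub_add_sum_range_le (x := -x) (by rw [abs_neg, abs_of_pos hx0]; linarith) 5
  rw [abs_of_pos hx0] at hl1
  rw [abs_neg, abs_of_pos hx0, sub_neg_eq_add] at hl2
  have hden : 0 < 1 - x := by linarith
  obtain ⟨a1, a2⟩ := abs_le.1 hl1
  obtain ⟨b1, b2⟩ := abs_le.1 hl2
  simp only [Finset.sum_range_succ, Finset.sum_range_zero] at a1 a2 b1 b2
  norm_num [neg_pow] at a1 a2 b1 b2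
  have hE : x ^ 6 / (1 - x) ≤ 2 * x ^ 6 := by
    rw [div_le_iff₀ hden]; nlinarith [pow_nonneg hx0.le 6]
  rw [hart]
  linarith

/-- INNER side, SHARP form: if `0 < ε ≤ β₇` is a float and `ε − ε³/3 + (2/15)ε⁵ − ε⁷/5 ≤ f ε < ε`, then
`RN(f ε) = ε` for every round-to-nearest. Below `β₆` this is `rn_eq_of_inner_third`; at `ε = β₇` (the only
float in `(β₆, β₇]`) the quintic term decides: `β₇³/3 − (2/15)β₇⁵ + β₇⁷/5 < 2^−80 < β₇³/3` (`norm_num`).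
[cite: DedinechinEtAl2013, Table I] -/
theorem rn_eq_of_inner_third_sharp (hRN : IsRoundNearest 53 RN) {f : ℝ → ℝ} {ε : ℝ} (hε : IsFloat 53 ε)
    (h0 : 0 < ε) (hβ : ε ≤ beta7) (hf1 : f ε < ε)
    (hf2 : ε - ε ^ 3 / 3 + 2 / 15 * ε ^ 5 - ε ^ 7 / 5 ≤ f ε) : RN (f ε) = ε := by
  rcases le_or_gt ε beta6 with hle | hlt
  · refine rn_eq_of_inner_third hRN hε h0 hle hf1 ?_
    have hεh : ε ≤ 1 / 2 := hle.trans (by rw [beta6_eq]; norm_num)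
    have hp5 : 0 ≤ ε ^ 5 := by positivity
    have hsq : ε ^ 2 ≤ 1 / 2 := by nlinarith
    have h75 : ε ^ 7 ≤ ε ^ 5 * (1 / 2) := by
      rw [show ε ^ 7 = ε ^ 5 * ε ^ 2 by ring]; exact mul_le_mul_of_nonneg_left hsq hp5
    linarith
  · have heq : ε = beta7 := le_antisymm hβ (beta7_le_of_beta6_lt hε hlt)
    rw [heq] at hε hf1 hf2 ⊢
    have h27 : (2 : ℝ) ^ (-27 : ℤ) < beta7 := by rw [beta7_eq]; norm_num
    have hnum : beta7 ^ 3 / 3 - 2 / 15 * beta7 ^ 5 + beta7 ^ 7 / 5 < 1 / 2 ^ 80 := by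
      rw [beta7_eq]; norm_num
    apply rn_eq_of_abs_sub_lt_53 hRN hε h27
    rw [abs_of_pos (by linarith), show (2 : ℝ) ^ ((-27 : ℤ) - 53) = 1 / 2 ^ 80 by norm_num]
    linarith

/-- **Corrected row `tanh`, SHARP form:** `RN(tanh ε) = ε` for every precision-53 float with
`|ε| ≤ β₇ = 8183583624766079·2^−79` and every round-to-nearest; the next float fails (`rn_tanh_succ_beta7`).
[cite: DedinechinEtAl2013, Table I] -/
theorem rn_tanh_tiny_sharp (hRN : IsRoundNearest 53 RN) {ε : ℝ} (hε : IsFloat 53 ε) (hβ : |ε| ≤ beta7) :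
    RN (Real.tanh ε) = ε := by
  have hpos : ∀ (RN : ℝ → ℝ), IsRoundNearest 53 RN → ∀ ε, IsFloat 53 ε → 0 < ε → ε ≤ beta7 →
      RN (Real.tanh ε) = ε := by
    intro RN hRN ε hε h0 hb
    have hb1 : ε ≤ 1 := hb.trans (by rw [beta7_eq]; norm_num)
    obtain ⟨_, t2⟩ := tanh_bounds h0 hb1
    obtain ⟨q1, _⟩ := tanh_quintic_bounds h0.le hb1
    exact rn_eq_of_inner_third_sharp hRN hε h0 hb t2 q1
  rcases lt_trichotomy ε 0 with hneg | hzero | hp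
  · exact rn_odd_of_pos Real.tanh_neg hpos hRN hε hneg (by rwa [abs_of_neg hneg] at hβ)
  · subst hzero
    rw [Real.tanh_zero]
    have h0 := hRN.nearest 0 0 ⟨0, 0, by norm_num, by simp⟩
    simp only [sub_zero, sub_self, abs_zero] at h0
    exact abs_nonpos_iff.1 h0
  · exact hpos RN hRN ε hε hp (by rwa [abs_of_pos hp] at hβ)

/-- **Corrected row `arctan`, SHARP form:** `RN(arctan ε) = ε` for every precision-53 float with
`|ε| ≤ β₇` and every round-to-nearest; the next float fails (`rn_arctan_succ_beta7`).
[cite: DedinechinEtAl2013, Table I] -/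
theorem rn_arctan_tiny_sharp (hRN : IsRoundNearest 53 RN) {ε : ℝ} (hε : IsFloat 53 ε) (hβ : |ε| ≤ beta7) :
    RN (Real.arctan ε) = ε := by
  have hpos : ∀ (RN : ℝ → ℝ), IsRoundNearest 53 RN → ∀ ε, IsFloat 53 ε → 0 < ε → ε ≤ beta7 →
      RN (Real.arctan ε) = ε := by
    intro RN hRN ε hε h0 hb
    have hb1 : ε < Real.pi / 2 := by
      have := Real.pi_gt_three; rw [beta7_eq] at hb; norm_num at hb; linarith
    have hε1 : ε ≤ 1 := hb.trans (by rw [beta7_eq]; norm_num)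
    obtain ⟨q1, _⟩ := arctan_quintic_bounds h0.le
    have h75 : ε ^ 7 ≤ ε ^ 5 := pow_le_pow_of_le_one h0.le hε1 (by norm_num)
    have hp7 : 0 ≤ ε ^ 7 := by positivity
    exact rn_eq_of_inner_third_sharp hRN hε h0 hb
      (by have := Real.lt_tan h0 hb1
          calc Real.arctan ε < Real.arctan (Real.tan ε) := Real.arctan_strictMono this
            _ = ε := Real.arctan_tan (by linarith) hb1)
      (by linarith)
  rcases lt_trichotomy ε 0 with hneg | hzero | hp
  · exact rn_odd_of_pos Real.arctan_neg hpos hRN hε hneg (by rwa [abs_of_neg hneg] at hβ)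
  · subst hzero
    rw [Real.arctan_zero]
    have h0 := hRN.nearest 0 0 ⟨0, 0, by norm_num, by simp⟩
    simp only [sub_zero, sub_self, abs_zero] at h0
    exact abs_nonpos_iff.1 h0
  · exact hpos RN hRN ε hε hp (by rwa [abs_of_pos hp] at hβ)

/-- **`β₆` is sharp for `tan`:** at the next float, `RN(tan β₇) = β₇ + 2^−79 ≠ β₇` for EVERY round-to-nearest
(`tan β₇ − β₇ ≥ β₇³/3 > 2^−80`, the half-gap, by `17·10^−18` of it — no tie). [cite: DedinechinEtAl2013, Table I] -/
theorem rn_tan_beta7 (hRN : IsRoundNearest 53 RN) :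
    RN (Real.tan beta7) = beta7 + (2 : ℝ) ^ (-79 : ℤ) ∧ beta7 + (2 : ℝ) ^ (-79 : ℤ) ≠ beta7 := by
  obtain ⟨_, hf8, _, _, _⟩ := beta7_isFloat
  have hb0 : 0 < beta7 := by rw [beta7_eq]; norm_num
  have hb1 : beta7 ≤ 1 / 2 := by rw [beta7_eq]; norm_num
  have lo := add_cube_div_three_le_tan hb0.le (by linarith)
  obtain ⟨_, hi⟩ := tan_bounds hb0 hb1
  refine ⟨?_, (lt_add_of_pos_right _ (by positivity)).ne'⟩
  have h27 : (2 : ℝ) ^ (-27 : ℤ) < beta7 + (2 : ℝ) ^ (-79 : ℤ) := by rw [beta7_eq]; norm_num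
  apply rn_eq_of_abs_sub_lt_53 hRN hf8 h27
  have hn1 : (1 : ℝ) / 2 ^ 80 < beta7 ^ 3 / 3 := by rw [beta7_eq]; norm_num
  have hn2 : beta7 ^ 3 / 3 + beta7 ^ 5 / 2 < 3 * ((1 : ℝ) / 2 ^ 80) := by rw [beta7_eq]; norm_num
  rw [show (2 : ℝ) ^ ((-27 : ℤ) - 53) = 1 / 2 ^ 80 by norm_num,
    show (2 : ℝ) ^ (-79 : ℤ) = 2 * (1 / 2 ^ 80) by norm_num, abs_sub_lt_iff]
  constructor <;> linarith

/-- **`β₆` is sharp for `atanh`:** `RN(atanh β₇) = β₇ + 2^−79 ≠ β₇` for every round-to-nearest.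
[cite: DedinechinEtAl2013, Table I] -/
theorem rn_artanh_beta7 (hRN : IsRoundNearest 53 RN) :
    RN (Real.artanh beta7) = beta7 + (2 : ℝ) ^ (-79 : ℤ) ∧ beta7 + (2 : ℝ) ^ (-79 : ℤ) ≠ beta7 := by
  obtain ⟨_, hf8, _, _, _⟩ := beta7_isFloat
  have hb0 : 0 < beta7 := by rw [beta7_eq]; norm_num
  have hb1 : beta7 ≤ 1 / 8 := by rw [beta7_eq]; norm_num
  have lo := artanh_lower_quintic hb0 hb1
  obtain ⟨_, hi⟩ := artanh_bounds hb0 hb1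
  refine ⟨?_, (lt_add_of_pos_right _ (by positivity)).ne'⟩
  have h27 : (2 : ℝ) ^ (-27 : ℤ) < beta7 + (2 : ℝ) ^ (-79 : ℤ) := by rw [beta7_eq]; norm_num
  apply rn_eq_of_abs_sub_lt_53 hRN hf8 h27
  have hn1 : (1 : ℝ) / 2 ^ 80 < beta7 ^ 3 / 3 + beta7 ^ 5 / 5 - 2 * beta7 ^ 6 := by rw [beta7_eq]; norm_num
  have hn2 : beta7 ^ 3 / 3 + beta7 ^ 5 / 2 < 3 * ((1 : ℝ) / 2 ^ 80) := by rw [beta7_eq]; norm_num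
  rw [show (2 : ℝ) ^ ((-27 : ℤ) - 53) = 1 / 2 ^ 80 by norm_num,
    show (2 : ℝ) ^ (-79 : ℤ) = 2 * (1 / 2 ^ 80) by norm_num, abs_sub_lt_iff]
  constructor <;> linarith

/-- **`β₇` is sharp for `tanh`:** at the next float `β₇ + 2^−79 = 8183583624766080·2^−79`,
`RN(tanh (β₇ + 2^−79)) = β₇ ≠ β₇ + 2^−79` for every round-to-nearest (the deviation exceeds the half-gap
`2^−80` by `3·10^−16` of it). [cite: DedinechinEtAl2013, Table I] -/
theorem rn_tanh_succ_beta7 (hRN : IsRoundNearest 53 RN) :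
    RN (Real.tanh (beta7 + (2 : ℝ) ^ (-79 : ℤ))) = beta7 ∧ beta7 ≠ beta7 + (2 : ℝ) ^ (-79 : ℤ) := by
  obtain ⟨hf7, _, _, _, _⟩ := beta7_isFloat
  have hb0 : 0 < beta7 + (2 : ℝ) ^ (-79 : ℤ) := by rw [beta7_eq]; norm_num
  have hb1 : beta7 + (2 : ℝ) ^ (-79 : ℤ) ≤ 1 := by rw [beta7_eq]; norm_num
  obtain ⟨lo, _⟩ := tanh_bounds hb0 hb1
  obtain ⟨_, hi⟩ := tanh_quintic_bounds hb0.le hb1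
  refine ⟨?_, (lt_add_of_pos_right _ (by positivity)).ne⟩
  have h27 : (2 : ℝ) ^ (-27 : ℤ) < beta7 := by rw [beta7_eq]; norm_num
  apply rn_eq_of_abs_sub_lt_53 hRN hf7 h27
  generalize hb8 : beta7 + (2 : ℝ) ^ (-79 : ℤ) = b8 at lo hi
  have hb8v : b8 = 8183583624766080 / 2 ^ 79 := by rw [← hb8, beta7_eq]; norm_num
  have hb7v : beta7 = b8 - 2 * (1 / 2 ^ 80) := by rw [hb8v, beta7_eq]; norm_num
  have hn1 : (1 : ℝ) / 2 ^ 80 < b8 ^ 3 / 3 - 2 / 15 * b8 ^ 5 := by rw [hb8v]; norm_num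
  have hn2 : b8 ^ 3 / 3 < 3 * ((1 : ℝ) / 2 ^ 80) := by rw [hb8v]; norm_num
  rw [show (2 : ℝ) ^ ((-27 : ℤ) - 53) = 1 / 2 ^ 80 by norm_num, hb7v, abs_sub_lt_iff]
  constructor <;> linarith

/-- **`β₇` is sharp for `arctan`:** `RN(arctan (β₇ + 2^−79)) = β₇ ≠ β₇ + 2^−79` for every round-to-nearest.
[cite: DedinechinEtAl2013, Table I] -/
theorem rn_arctan_succ_beta7 (hRN : IsRoundNearest 53 RN) :
    RN (Real.arctan (beta7 + (2 : ℝ) ^ (-79 : ℤ))) = beta7 ∧ beta7 ≠ beta7 + (2 : ℝ) ^ (-79 : ℤ) := by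
  obtain ⟨hf7, _, _, _, _⟩ := beta7_isFloat
  have hb0 : 0 < beta7 + (2 : ℝ) ^ (-79 : ℤ) := by rw [beta7_eq]; norm_num
  obtain ⟨_, hi⟩ := arctan_quintic_bounds hb0.le
  have lo := sub_cube_div_three_lt_arctan hb0
  refine ⟨?_, (lt_add_of_pos_right _ (by positivity)).ne⟩
  have h27 : (2 : ℝ) ^ (-27 : ℤ) < beta7 := by rw [beta7_eq]; norm_num
  apply rn_eq_of_abs_sub_lt_53 hRN hf7 h27
  generalize hb8 : beta7 + (2 : ℝ) ^ (-79 : ℤ) = b8 at lo hi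
  have hb8v : b8 = 8183583624766080 / 2 ^ 79 := by rw [← hb8, beta7_eq]; norm_num
  have hb7v : beta7 = b8 - 2 * (1 / 2 ^ 80) := by rw [hb8v, beta7_eq]; norm_num
  have hn1 : (1 : ℝ) / 2 ^ 80 < b8 ^ 3 / 3 - b8 ^ 5 / 5 := by rw [hb8v]; norm_num
  have hn2 : b8 ^ 3 / 3 < 3 * ((1 : ℝ) / 2 ^ 80) := by rw [hb8v]; norm_num
  rw [show (2 : ℝ) ^ ((-27 : ℤ) - 53) = 1 / 2 ^ 80 by norm_num, hb7v, abs_sub_lt_iff]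
  constructor <;> linarith

end SharpCorrected

end Literature.ComputerArithmetic.DeDinechinLauterMullerTorres2013
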